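import Mathlib.Combinatorics.SetFamily.FourFunctions
import Mathlib.Analysis.SpecialFunctions.Log.Basic
import Literature.Probability.LatticeModels.SignedFieldDomination
import Literature.Probability.LatticeModels.IsingEffectiveField
import HarnessLib

/-!
# Ding–Song–Sun 2022, Theorem 1.1 — proof (discharge of `DingSongSun2022_signedFieldDomination`)

Topic `Probability/LatticeModels`; sibling of `SignedFieldDomination.lean`, whose named fact
`DingSongSun2022_signedFieldDomination` (J. Ding, J. Song, R. Sun, *A new correlation inequality
for Ising models with external fields*, Probab. Theory Relat. Fields 186 (2023) 477–492 =
arXiv:2107.09243, Theorem 1.1: for the ferromagnetic Ising model on a finite graph, any field `g`,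
any `h ≥ 0` and any vertex `o`, `⟨σ_o⟩_{g+h} - ⟨σ_o⟩_{g-h} ≤ ⟨σ_o⟩_h - ⟨σ_o⟩_{-h}`) is
DISCHARGED here: `DingSongSun2022_signedFieldDomination_holds`, sorry-free, by formalising the
printed proof (§2 of the paper) verbatim.

## The general model (namespace `DingSongSun2022`)

The printed induction removes vertices from the graph and moves couplings into fields, so it is
run on the Ising model of the paper's eq. (1.1) with GENERAL pair couplings: a finite index type
`ι`, a coupling matrix `J : ι → ι → ℝ` with `J ≥ 0` (energy `∑_{i,j} J_{ij} σ_iσ_j`, ordered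
pairs), a field `ψ : ι → ℝ`, Gibbs weight `weight J ψ σ = exp (∑ Jσσ + ∑ ψσ)` on
`SpinConfig ι = ι → ℤˣ`, expectations `avg J ψ F`. "Removing the vertex `v`" is realised on the
same index type by DECOUPLING it (`Jdec v J`: all couplings of `v` set to `0`) and adding the
induced field `kvec v J` (`k_u = J_{vu} + J_{uv}`) to the others — exactly the paper's remark that
a frozen spin "has the same effect as removing `u` from the graph and adding an extra field
`±J_{uv}` to each neighbour" (§1). The main theorem for this model is
`DingSongSun2022.pair_signedFieldDomination`.

## The printed proof and its formalisation (Ding–Song–Sun 2022, §2)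

* Induction (†) on `(|V|, |V_+|)`, `V_+ = {h > 0}`: here the single measure
  `measure J h = #(coupled vertices)·(|ι|+1) + #{h ≠ 0}` (`measure_update_lt`, `measure_Jdec_lt`).
* Base cases: `h ≡ 0` (both sides vanish) and `V_+ ⊆ {o}` (`one_spin_case`): the effective-field
  formula (2.3)–(2.4), `⟨σ_v⟩_{ψ^{(v↦t)}} = tanh (λ + t)` (`avg_update_spinAt_self`, written with
  the odds `ratio v J ψ = e^{2λ}` and `th u = (u-1)/(u+1) = tanh (½ log u)`), `λ(0) = 0` by the
  spin-flip symmetry (`ratio_eq_one_of_off`, `avg_neg_field_spinAt`), and the one-spin inequality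
  (2.2) (`th_one_spin`).
* Induction step, `v ≠ o` with `h_v > 0` (`main_step`): the decomposition (2.5)/(2.8) over
  `σ_v = ±1` (`avg_decomp`; the conditional expectations `⟨σ_o | σ_v = ±1⟩_φ` are the
  expectations `⟨σ_o⟩_{φ ± k}` of the decoupled system, `avg_Jdec_eq_pin`, and do not depend on
  the field at `v`, `avg_Jdec_congr`), `c_± ≥ 0` by FKG (`avg_Jdec_sub_le_add`, from
  `avg_mono_field`, Mathlib's `fkg` on `{±1}^ι` with the lattice condition
  `weight_mul_weight_le`), Lemma 2.1 (`scalar_lemma21`, in the variables (2.13)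
  `a = tanh x, b = tanh y, c = tanh h_v`, with the explicit choice of `d = tanh H` of
  (2.16)–(2.17), `exists_d`; the worst case (2.11)–(2.12) uses the induction hypothesis at the
  vertex `v`), the induction hypotheses (2.6) (same couplings with the field at `v` frozen to the
  common value `H`; decoupled system with `h + k`), and the mixture identity (2.7)
  (`α = (1 - tanh h_v)/(1 + tanh z tanh h_v)`, eq. (2.11)). A vertex `v ∈ V_+ ∖ {o}` carrying no
  coupling is handled by dropping `h_v` (nothing depends on it), a case the paper's `|V|`-count
  does not need to distinguish. Deviation: the paper also invokes FKG for `x ≥ y`; the argument as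
  written here does not need it.
* Bridge (`fieldExpect_spinAt_eq_avg`): for `o ∈ Λ` the tree's `fieldExpect G Λ β φ bc (σ_o)`
  (Friedli–Velenik 2017, §3.1/§3.8.1) is `avg` of the pair model on `↥Λ` with couplings
  `couplingMatrix G Λ β` (`β/2 · 1_{x∼y}`; the double counting `sum_edgesIn_bondSpin_eq_half`) and
  field `siteField` = `β φ + β·(boundary spins as a field, bcField)` (the boundary bonds regrouped,
  `sum_interactionEdges_bondSpin`, via the tree's `sum_edgeBoundary_bondSpin`); for `o ∉ Λ` the
  spin is frozen (`fieldExpect_spinAt_of_not_mem`) and both sides of Theorem 1.1 vanish.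

## References

* [DingSongSun2022] J. Ding, J. Song, R. Sun, Probab. Theory Relat. Fields 186 (2023) 477–492 =
  arXiv:2107.09243: §1 eq. (1.1), Theorem 1.1; §2 (proof: (†), eqs. (2.1)–(2.17), Lemma 2.1).
* [FriedliVelenik2017] S. Friedli, Y. Velenik, *Statistical Mechanics of Lattice Systems*
  (CUP 2017), §3.1 eq. (3.6), §3.6.2 Thm. 3.21 (FKG), §3.8.1 p. 141, §3.8.3 eq. (3.53).
* Mathlib: `Mathlib.Combinatorics.SetFamily.FourFunctions` (`fkg`).
-/

noncomputable section

open Finset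

namespace Literature.Probability.LatticeModels

namespace DingSongSun2022


/-- `th u = (u - 1)/(u + 1)` (`= tanh (log u / 2)` for `u > 0`): the one-spin magnetisation as a
function of the odds `u = μ(σ = +1)/μ(σ = -1)`. [cite: DingSongSun2022, §2, eq. (2.1)] -/
def th (u : ℝ) : ℝ := (u - 1) / (u + 1)

/-- `th u < 1` for `u > 0` (a finite effective field has `|tanh| < 1`). [folklore] -/
theorem th_lt_one {u : ℝ} (hu : 0 < u) : th u < 1 := by
  unfold th
  rw [div_lt_one (by linarith)]
  linarith

/-- `-1 < th u` for `u > 0`. [folklore] -/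
theorem neg_one_lt_th {u : ℝ} (hu : 0 < u) : -1 < th u := by
  unfold th
  rw [lt_div_iff₀ (by linarith)]
  linarith

/-- `th u ≥ 0` for `u ≥ 1` (`tanh` of a nonnegative number). [folklore] -/
theorem th_nonneg {u : ℝ} (hu : 1 ≤ u) : 0 ≤ th u := by
  unfold th
  exact div_nonneg (by linarith) (by linarith)

/-- `th 1 = 0` (`tanh 0 = 0`). [folklore] -/
theorem th_one : th 1 = 0 := by simp [th]

/-- The addition formula `tanh (x + y) = (tanh x + tanh y)/(1 + tanh x tanh y)` in the odds
variables. [cite: DingSongSun2022, §2, after eq. (2.13)] -/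
theorem th_mul {u w : ℝ} (hu : 0 < u) (hw : 0 < w) :
    th (u * w) = (th u + th w) / (1 + th u * th w) := by
  unfold th
  have h1 : u + 1 ≠ 0 := by positivity
  have h2 : w + 1 ≠ 0 := by positivity
  have h3 : u * w + 1 ≠ 0 := by positivity
  have h4 : (u + 1) * (w + 1) + (u - 1) * (w - 1) ≠ 0 := by nlinarith
  rw [div_add_div _ _ h1 h2, div_mul_div_comm, one_add_div (mul_ne_zero h1 h2),
    div_div_div_cancel_right₀ (mul_ne_zero h1 h2), div_eq_div_iff h3 h4]
  ring

/-- `th (1/u) = -th u` (`tanh` is odd). [folklore] -/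
theorem th_inv {u : ℝ} (hu : 0 < u) : th u⁻¹ = -th u := by
  unfold th
  have h1 : u + 1 ≠ 0 := by positivity
  have h2 : u ≠ 0 := hu.ne'
  field_simp
  ring

/-- The inverse of `th` on `(-1, 1)`: `th ((1+d)/(1-d)) = d`. [folklore] -/
theorem th_ratio {d : ℝ} (hd' : d < 1) : th ((1 + d) / (1 - d)) = d := by
  unfold th
  have h1 : 1 - d ≠ 0 := by linarith
  field_simp
  ring

/-- **The one-spin inequality** (the base case `|V| = |V_+| = 1` of Ding–Song–Sun 2022, §2,
eq. (2.2): `tanh (g + h) - tanh (g - h) ≤ tanh h - tanh (-h)`), in odds variables `r = e^{2g}`,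
`u = e^{2h} ≥ 1`. [cite: DingSongSun2022, §2, eq. (2.2)] -/
theorem th_one_spin {r u : ℝ} (hr : 0 < r) (hu : 1 ≤ u) :
    th (r * u) - th (r * u⁻¹) ≤ th u - th u⁻¹ := by
  have hu0 : 0 < u := by linarith
  rw [th_inv hu0]
  have e1 : th (r * u) - th (r * u⁻¹) = 2 * r * (u ^ 2 - 1) / ((r * u + 1) * (r + u)) := by
    unfold th
    have h1 : r * u + 1 ≠ 0 := by positivity
    have h2 : r + u ≠ 0 := by positivity
    have h3 : u ≠ 0 := hu0.ne'
    field_simp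
    ring
  have e2 : th u - -th u = 2 * (u ^ 2 - 1) / ((u + 1) * (u + 1)) := by
    unfold th
    have h1 : u + 1 ≠ 0 := by positivity
    field_simp
    ring
  rw [e1, e2, div_le_div_iff₀ (by positivity) (by positivity)]
  have key : 0 ≤ 2 * (u ^ 2 - 1) * (u * (r - 1) ^ 2) :=
    mul_nonneg (mul_nonneg zero_le_two (by nlinarith)) (mul_nonneg hu0.le (sq_nonneg _))
  nlinarith [key]

/-- **The choice of `d = tanh H`** (Ding–Song–Sun 2022, proof of Lemma 2.1, eqs. (2.16)–(2.17)):
for `a, b ∈ (-1, 1)`, `c ∈ [0, 1)` there is `d ∈ (-1, 1)` with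
`(1 + ac)(1 - d) ≤ (1 + ad)(1 + (a - b)c/2)` and `(1 - bc)(1 + d) ≤ (1 + bd)(1 + (a - b)c/2)`.
[cite: DingSongSun2022, Lemma 2.1, proof, eqs. (2.16)–(2.17)] -/
theorem exists_d {a b c : ℝ} (ha : -1 < a) (hb : -1 < b) (hb' : b < 1)
    (hc : 0 ≤ c) (hc' : c < 1) :
    ∃ d : ℝ, -1 < d ∧ d < 1 ∧
      (1 + a * c) * (1 - d) ≤ (1 + a * d) * (1 + (a - b) * c / 2) ∧
      (1 - b * c) * (1 + d) ≤ (1 + b * d) * (1 + (a - b) * c / 2) := by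
  set D : ℝ := 1 + (a - b) * c / 2 with hDdef
  have hD : 0 < D := by rw [hDdef]; nlinarith
  set L : ℝ := (1 + a * c) / D with hLdef
  set L' : ℝ := (1 - b * c) / D with hL'def
  have hLD : L * D = 1 + a * c := by rw [hLdef]; field_simp
  have hL'D : L' * D = 1 - b * c := by rw [hL'def]; field_simp
  have hLL' : L + L' = 2 := by
    rw [hLdef, hL'def, ← add_div, div_eq_iff hD.ne', hDdef]; ring
  rcases le_or_gt 0 (a + b) with hab | hab
  · -- case `a + b ≥ 0`
    have hL1 : 1 ≤ L := by
      rw [hLdef, le_div_iff₀ hD, hDdef]; nlinarith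
    have hLa : 0 < L + a := by linarith
    refine ⟨(L - 1) / (L + a), ?_, ?_, ?_, ?_⟩
    · rw [lt_div_iff₀ hLa]; nlinarith
    · rw [div_lt_one hLa]; linarith
    · have h1 : 1 - (L - 1) / (L + a) = (a + 1) / (L + a) := by field_simp; ring
      have h2 : 1 + a * ((L - 1) / (L + a)) = L * (1 + a) / (L + a) := by field_simp; ring
      rw [h1, h2, ← hLD]
      apply le_of_eq
      ring
    · have h3 : 1 + (L - 1) / (L + a) = (2 * L + a - 1) / (L + a) := by field_simp; ring
      have h4 : 1 + b * ((L - 1) / (L + a)) = (L + a + b * (L - 1)) / (L + a) := by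
        field_simp
      have h5 : 1 - b * c = (2 - L) * D := by rw [← hL'D]; congr 1; linarith
      rw [h3, h4, h5]
      rw [show (2 - L) * D * ((2 * L + a - 1) / (L + a)) = ((2 - L) * (2 * L + a - 1)) / (L + a) * D by
        ring, show (L + a + b * (L - 1)) / (L + a) * D = (L + a + b * (L - 1)) / (L + a) * D by rfl]
      refine mul_le_mul_of_nonneg_right ?_ hD.le
      refine div_le_div_of_nonneg_right ?_ hLa.le
      nlinarith [sq_nonneg (L - 1), mul_nonneg hab (sub_nonneg.2 hL1)]
  · -- case `a + b < 0`, mirror image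
    have hL1 : 1 ≤ L' := by
      rw [hL'def, le_div_iff₀ hD, hDdef]; nlinarith
    have hLb : 0 < L' - b := by linarith
    refine ⟨(1 - L') / (L' - b), ?_, ?_, ?_, ?_⟩
    · rw [lt_div_iff₀ hLb]; nlinarith
    · rw [div_lt_one hLb]; linarith
    · have h3 : 1 - (1 - L') / (L' - b) = (2 * L' - b - 1) / (L' - b) := by field_simp; ring
      have h4 : 1 + a * ((1 - L') / (L' - b)) = (L' - b + a * (1 - L')) / (L' - b) := by
        field_simp
      have h5 : 1 + a * c = (2 - L') * D := by rw [← hLD]; congr 1; linarith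
      rw [h3, h4, h5]
      rw [show (2 - L') * D * ((2 * L' - b - 1) / (L' - b)) = ((2 - L') * (2 * L' - b - 1)) / (L' - b) * D by
        ring, show (L' - b + a * (1 - L')) / (L' - b) * D = (L' - b + a * (1 - L')) / (L' - b) * D by rfl]
      refine mul_le_mul_of_nonneg_right ?_ hD.le
      refine div_le_div_of_nonneg_right ?_ hLb.le
      nlinarith [sq_nonneg (L' - 1), mul_nonneg (neg_nonneg.2 hab.le) (sub_nonneg.2 hL1)]
    · have h1 : 1 + (1 - L') / (L' - b) = (1 - b) / (L' - b) := by field_simp; ring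
      have h2 : 1 + b * ((1 - L') / (L' - b)) = L' * (1 - b) / (L' - b) := by field_simp; ring
      rw [h1, h2, ← hL'D]
      apply le_of_eq
      ring

/-- **Lemma 2.1 of Ding–Song–Sun 2022, scalar form.** In the variables of eq. (2.13)
(`a = tanh x`, `b = tanh y`, `c = tanh h_v`) and `t = tanh z`, under the induction constraint
`tanh x - tanh y ≤ 2 tanh z` (eq. (2.12)) and with `α = (1 - c)/(1 + t c)` (eq. (2.11)), for all
`c₊, c₋ ≥ 0` there is `d = tanh H ∈ (-1, 1)` such that (eq. (2.9))
`c₊ (a+c)/(1+ac) - c₋ (b-c)/(1-bc) ≤ c₊ (α (a+d)/(1+ad) + 1 - α) - c₋ (α (b+d)/(1+bd) - (1-α))`.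
[cite: DingSongSun2022, Lemma 2.1 and its proof, eqs. (2.9)–(2.17)] -/
theorem scalar_lemma21 {a b c t α cp cm : ℝ} (ha : -1 < a) (ha' : a < 1) (hb : -1 < b)
    (hb' : b < 1) (hc : 0 ≤ c) (hc' : c < 1) (ht : -1 < t) (hab : a - b ≤ 2 * t)
    (hα : α = (1 - c) / (1 + t * c)) (hcp : 0 ≤ cp) (hcm : 0 ≤ cm) :
    ∃ d : ℝ, -1 < d ∧ d < 1 ∧
      cp * ((a + c) / (1 + a * c)) - cm * ((b - c) / (1 - b * c)) ≤
        cp * (α * ((a + d) / (1 + a * d)) + (1 - α)) -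
          cm * (α * ((b + d) / (1 + b * d)) - (1 - α)) := by
  obtain ⟨d, hd, hd', h1, h2⟩ := exists_d ha hb hb' hc hc'
  refine ⟨d, hd, hd', ?_⟩
  set D : ℝ := 1 + (a - b) * c / 2 with hDdef
  have hD : 0 < D := by rw [hDdef]; nlinarith
  have htc : 0 < 1 + t * c := by nlinarith
  have hαle : α ≤ (1 - c) / D := by
    rw [hα]
    exact div_le_div_of_nonneg_left (by linarith) hD (by rw [hDdef]; nlinarith)
  have had : 0 < 1 + a * d := by nlinarith
  have hbd : 0 < 1 + b * d := by nlinarith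
  have hac : 0 < 1 + a * c := by nlinarith
  have hbc : 0 < 1 - b * c := by nlinarith
  have hac' : 1 + a * c ≠ 0 := hac.ne'
  have hbc' : 1 - b * c ≠ 0 := hbc.ne'
  have had' : 1 + a * d ≠ 0 := had.ne'
  have hbd' : 1 + b * d ≠ 0 := hbd.ne'
  -- the coefficient of `c₊`
  have hX1 : (a + c) / (1 + a * c) ≤ α * ((a + d) / (1 + a * d)) + (1 - α) := by
    have key : α * ((1 - d) / (1 + a * d)) ≤ (1 - c) / (1 + a * c) := by
      calc α * ((1 - d) / (1 + a * d)) ≤ (1 - c) / D * ((1 - d) / (1 + a * d)) :=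
            mul_le_mul_of_nonneg_right hαle (div_nonneg (by linarith) had.le)
        _ = (1 - c) * ((1 - d) / (D * (1 + a * d))) := by
            rw [div_mul_div_comm, mul_div_assoc]
        _ ≤ (1 - c) * (1 / (1 + a * c)) := by
            refine mul_le_mul_of_nonneg_left ?_ (by linarith)
            rw [div_le_div_iff₀ (mul_pos hD had) hac, one_mul]
            calc (1 - d) * (1 + a * c) = (1 + a * c) * (1 - d) := by ring
              _ ≤ (1 + a * d) * (1 + (a - b) * c / 2) := h1
              _ = D * (1 + a * d) := by rw [hDdef]; ring
        _ = (1 - c) / (1 + a * c) := by rw [mul_one_div]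
    have e1 : α * ((a + d) / (1 + a * d)) + (1 - α) - (a + c) / (1 + a * c) =
        (1 - a) * ((1 - c) / (1 + a * c) - α * ((1 - d) / (1 + a * d))) := by
      field_simp
      ring
    have : 0 ≤ (1 - a) * ((1 - c) / (1 + a * c) - α * ((1 - d) / (1 + a * d))) :=
      mul_nonneg (by linarith) (by linarith)
    linarith
  -- the coefficient of `c₋`
  have hX2 : α * ((b + d) / (1 + b * d)) - (1 - α) ≤ (b - c) / (1 - b * c) := by
    have key : α * ((1 + d) / (1 + b * d)) ≤ (1 - c) / (1 - b * c) := by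
      calc α * ((1 + d) / (1 + b * d)) ≤ (1 - c) / D * ((1 + d) / (1 + b * d)) :=
            mul_le_mul_of_nonneg_right hαle (div_nonneg (by linarith) hbd.le)
        _ = (1 - c) * ((1 + d) / (D * (1 + b * d))) := by
            rw [div_mul_div_comm, mul_div_assoc]
        _ ≤ (1 - c) * (1 / (1 - b * c)) := by
            refine mul_le_mul_of_nonneg_left ?_ (by linarith)
            rw [div_le_div_iff₀ (mul_pos hD hbd) hbc, one_mul]
            calc (1 + d) * (1 - b * c) = (1 - b * c) * (1 + d) := by ring
              _ ≤ (1 + b * d) * (1 + (a - b) * c / 2) := h2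
              _ = D * (1 + b * d) := by rw [hDdef]; ring
        _ = (1 - c) / (1 - b * c) := by rw [mul_one_div]
    have e1 : (b - c) / (1 - b * c) - (α * ((b + d) / (1 + b * d)) - (1 - α)) =
        (1 + b) * ((1 - c) / (1 - b * c) - α * ((1 + d) / (1 + b * d))) := by
      field_simp
      ring
    have : 0 ≤ (1 + b) * ((1 - c) / (1 - b * c) - α * ((1 + d) / (1 + b * d))) :=
      mul_nonneg (by linarith) (by linarith)
    linarith
  have i1 := mul_le_mul_of_nonneg_left hX1 hcp
  have i2 := mul_le_mul_of_nonneg_left hX2 hcm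
  linarith



variable {ι : Type*} [Fintype ι] [DecidableEq ι]

/-! ### Pinned sums over `{σ : σ_v = s}` and the spin flip at one vertex -/

/-- The sum of `F` over the configurations with `σ_v = s` (the unnormalised form of the
conditioning `⟨ · | σ_v = ±1⟩` of Ding–Song–Sun 2022, §2, eq. (2.5)). [cite: DingSongSun2022, §2, eq. (2.5)] -/
def pin (v : ι) (s : ℤˣ) (F : SpinConfig ι → ℝ) : ℝ := ∑ σ, if σ v = s then F σ else 0

/-- `∑_σ F = ∑_{σ_v = +1} F + ∑_{σ_v = -1} F`. [folklore] -/
theorem pin_one_add_pin_neg_one (v : ι) (F : SpinConfig ι → ℝ) :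
    pin v 1 F + pin v (-1) F = ∑ σ, F σ := by
  unfold pin
  rw [← Finset.sum_add_distrib]
  refine Finset.sum_congr rfl fun σ _ => ?_
  rcases Int.units_eq_one_or (σ v) with h | h
  · rw [if_pos h, if_neg (by rw [h]; decide), add_zero]
  · rw [if_neg (by rw [h]; decide), if_pos h, zero_add]

/-- A factor depending on `σ_v` only comes out of a pinned sum. [folklore] -/
theorem pin_mul_apply (v : ι) (s : ℤˣ) (c : ℤˣ → ℝ) (F : SpinConfig ι → ℝ) :
    pin v s (fun σ => c (σ v) * F σ) = c s * pin v s F := by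
  unfold pin
  rw [Finset.mul_sum]
  refine Finset.sum_congr rfl fun σ _ => ?_
  dsimp only
  split_ifs with h
  · rw [h]
  · rw [mul_zero]

/-- Linearity of pinned sums. [folklore] -/
theorem pin_add (v : ι) (s : ℤˣ) (F G : SpinConfig ι → ℝ) :
    pin v s (fun σ => F σ + G σ) = pin v s F + pin v s G := by
  unfold pin
  rw [← Finset.sum_add_distrib]
  refine Finset.sum_congr rfl fun σ _ => ?_
  dsimp only
  split_ifs <;> simp

/-- Homogeneity of pinned sums. [folklore] -/
theorem pin_const_mul (v : ι) (s : ℤˣ) (c : ℝ) (F : SpinConfig ι → ℝ) :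
    pin v s (fun σ => c * F σ) = c * pin v s F := by
  unfold pin
  rw [Finset.mul_sum]
  refine Finset.sum_congr rfl fun σ _ => ?_
  dsimp only
  split_ifs <;> simp

/-- A pinned sum of a positive function is positive (the pinned set contains the constant
configuration `s`). [folklore] -/
theorem pin_pos (v : ι) (s : ℤˣ) {F : SpinConfig ι → ℝ} (hF : ∀ σ, 0 < F σ) : 0 < pin v s F := by
  unfold pin
  have hle : (if (fun _ : ι => s) v = s then F (fun _ => s) else 0) ≤
      ∑ σ, if σ v = s then F σ else 0 :=
    Finset.single_le_sum (f := fun σ : SpinConfig ι => if σ v = s then F σ else 0)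
      (fun σ _ => by split_ifs; exacts [(hF σ).le, le_rfl]) (Finset.mem_univ (fun _ : ι => s))
  rw [if_pos rfl] at hle
  exact lt_of_lt_of_le (hF _) hle

/-- Monotonicity of pinned sums in the integrand. [folklore] -/
theorem pin_nonneg (v : ι) (s : ℤˣ) {F : SpinConfig ι → ℝ} (hF : ∀ σ, 0 ≤ F σ) : 0 ≤ pin v s F := by
  unfold pin
  exact Finset.sum_nonneg fun σ _ => by split_ifs; exacts [hF σ, le_rfl]

/-- The spin flip at the vertex `v`. [folklore] -/
def flipAt (v : ι) (σ : SpinConfig ι) : SpinConfig ι := Function.update σ v (-σ v)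

omit [Fintype ι] in
/-- The flipped configuration at `v`. [folklore] -/
@[simp] theorem flipAt_apply_self (v : ι) (σ : SpinConfig ι) : flipAt v σ v = -σ v := by
  simp [flipAt]

omit [Fintype ι] in
/-- The flip at `v` does not change the other spins. [folklore] -/
theorem flipAt_apply_of_ne (v : ι) (σ : SpinConfig ι) {u : ι} (hu : u ≠ v) : flipAt v σ u = σ u := by
  simp [flipAt, hu]

omit [Fintype ι] in
/-- The flip at `v` is an involution. [folklore] -/
theorem flipAt_flipAt (v : ι) (σ : SpinConfig ι) : flipAt v (flipAt v σ) = σ := by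
  funext u
  by_cases hu : u = v
  · subst hu; simp [flipAt]
  · simp [flipAt, hu]

omit [Fintype ι] in
/-- The flip at `v` as a `Function.update`. [folklore] -/
theorem flipAt_eq_update (v : ι) (σ : SpinConfig ι) : flipAt v σ = Function.update σ v (-σ v) := rfl

/-- The flip at `v` as a permutation of the configurations. [folklore] -/
def flipEquiv (v : ι) : SpinConfig ι ≃ SpinConfig ι :=
  Function.Involutive.toPerm (flipAt v) (flipAt_flipAt v)

omit [Fintype ι] in
/-- `flipEquiv` acts as `flipAt`. [folklore] -/
@[simp] theorem flipEquiv_apply (v : ι) (σ : SpinConfig ι) : flipEquiv v σ = flipAt v σ := rfl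

/-- Flipping the pin: `∑_{σ_v = -s} F(σ) = ∑_{σ_v = s} F(σ^{(v)})`. [folklore] -/
theorem pin_neg_eq (v : ι) (s : ℤˣ) (F : SpinConfig ι → ℝ) :
    pin v (-s) F = pin v s (fun σ => F (flipAt v σ)) := by
  unfold pin
  rw [← Equiv.sum_comp (flipEquiv v) (fun σ => if σ v = -s then F σ else 0)]
  refine Finset.sum_congr rfl fun σ _ => ?_
  simp only [flipEquiv_apply, flipAt_apply_self, neg_inj]

/-- `F` does not depend on the spin at `v`. [folklore] -/
def IndepAt (v : ι) (F : SpinConfig ι → ℝ) : Prop := ∀ σ (s : ℤˣ), F (Function.update σ v s) = F σ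

omit [Fintype ι] in
/-- A `v`-independent observable is invariant under the flip at `v`. [folklore] -/
theorem IndepAt.flipAt {v : ι} {F : SpinConfig ι → ℝ} (hF : IndepAt v F) (σ : SpinConfig ι) :
    F (flipAt v σ) = F σ :=
  hF σ _

omit [Fintype ι] in
/-- Products of `v`-independent observables are `v`-independent. [folklore] -/
theorem IndepAt.mul {v : ι} {F G : SpinConfig ι → ℝ} (hF : IndepAt v F) (hG : IndepAt v G) :
    IndepAt v (fun σ => F σ * G σ) := fun σ s => by
  simp only [hF σ s, hG σ s]

omit [Fintype ι] in
/-- Constants are `v`-independent. [folklore] -/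
theorem indepAt_const (v : ι) (c : ℝ) : IndepAt v (fun _ => c) := fun _ _ => rfl

omit [Fintype ι] in
/-- `σ_o` is `v`-independent for `o ≠ v`. [folklore] -/
theorem indepAt_spinAt {o v : ι} (h : o ≠ v) : IndepAt v (spinAt o) := fun σ s => by
  simp [spinAt, Function.update_of_ne h]

/-- For `F` independent of `σ_v`, the two pinned sums agree. [folklore] -/
theorem IndepAt.pin_eq {v : ι} {F : SpinConfig ι → ℝ} (hF : IndepAt v F) (s s' : ℤˣ) :
    pin v s F = pin v s' F := by
  have key : ∀ s : ℤˣ, pin v (-s) F = pin v s F := fun s => by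
    rw [pin_neg_eq]
    unfold pin
    exact Finset.sum_congr rfl fun σ _ => by simp only [hF.flipAt]
  rcases Int.units_eq_one_or s with rfl | rfl <;> rcases Int.units_eq_one_or s' with rfl | rfl
  · rfl
  · exact (key 1).symm
  · exact key 1
  · rfl

/-- For `F` independent of `σ_v`, `∑_σ F = 2 ∑_{σ_v = s} F`. [folklore] -/
theorem IndepAt.sum_eq_two_mul_pin {v : ι} {F : SpinConfig ι → ℝ} (hF : IndepAt v F) (s : ℤˣ) :
    ∑ σ, F σ = 2 * pin v s F := by
  rw [← pin_one_add_pin_neg_one v, hF.pin_eq 1 s, hF.pin_eq (-1) s, two_mul]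

/-! ### The Ising model with general pair couplings (Ding–Song–Sun 2022, eq. (1.1)) -/

/-- The pair interaction `∑_{i,j} J_{ij} σ_i σ_j` of a coupling matrix `J` (ordered pairs, the
diagonal contributing the constant `∑ J_{ii}`; Ding–Song–Sun 2022, eq. (1.1), with `β` absorbed
into `J`). [cite: DingSongSun2022, §1, eq. (1.1)] -/
def pairEnergy (J : ι → ι → ℝ) (σ : SpinConfig ι) : ℝ := ∑ i, ∑ j, J i j * (spinAt i σ * spinAt j σ)

/-- The field term `∑_i ψ_i σ_i`. [cite: DingSongSun2022, §1, eq. (1.1)] -/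
def fieldEnergy (ψ : ι → ℝ) (σ : SpinConfig ι) : ℝ := ∑ i, ψ i * spinAt i σ

/-- The Gibbs weight `exp{∑ J_{ij} σ_iσ_j + ∑ ψ_i σ_i}` of `μ_ψ` (Ding–Song–Sun 2022, eq. (1.1)).
[cite: DingSongSun2022, §1, eq. (1.1)] -/
def weight (J : ι → ι → ℝ) (ψ : ι → ℝ) (σ : SpinConfig ι) : ℝ :=
  Real.exp (pairEnergy J σ + fieldEnergy ψ σ)

/-- Unnormalised expectation `Z_ψ ⟨F⟩_ψ`. [cite: DingSongSun2022, §1, eq. (1.1)] -/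
def wsum (J : ι → ι → ℝ) (ψ : ι → ℝ) (F : SpinConfig ι → ℝ) : ℝ := ∑ σ, weight J ψ σ * F σ

/-- The expectation `⟨F⟩_ψ` under `μ_ψ` (Ding–Song–Sun 2022, §1). [cite: DingSongSun2022, §1, eq. (1.1)] -/
def avg (J : ι → ι → ℝ) (ψ : ι → ℝ) (F : SpinConfig ι → ℝ) : ℝ := wsum J ψ F / wsum J ψ (fun _ => 1)

omit [DecidableEq ι] in
/-- Gibbs weights are positive. [folklore] -/
theorem weight_pos (J : ι → ι → ℝ) (ψ : ι → ℝ) (σ : SpinConfig ι) : 0 < weight J ψ σ := Real.exp_pos _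

/-- The partition function is positive. [folklore] -/
theorem wsum_one_pos (J : ι → ι → ℝ) (ψ : ι → ℝ) : 0 < wsum J ψ (fun _ => 1) := by
  unfold wsum
  exact Finset.sum_pos (fun σ _ => by rw [mul_one]; exact weight_pos J ψ σ) Finset.univ_nonempty

/-- Splitting an unnormalised expectation over the two values of `σ_v` (Ding–Song–Sun 2022, §2, eq. (2.5)). [cite: DingSongSun2022, §2, eq. (2.5)] -/
theorem wsum_eq_pin (J : ι → ι → ℝ) (ψ : ι → ℝ) (F : SpinConfig ι → ℝ) (v : ι) :
    wsum J ψ F = pin v 1 (fun σ => weight J ψ σ * F σ) + pin v (-1) (fun σ => weight J ψ σ * F σ) := by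
  rw [pin_one_add_pin_neg_one]; rfl

/-- `⟨a F + b⟩ = a ⟨F⟩ + b`. [folklore] -/
theorem avg_affine (J : ι → ι → ℝ) (ψ : ι → ℝ) (F : SpinConfig ι → ℝ) (a b : ℝ) :
    avg J ψ (fun σ => a * F σ + b) = a * avg J ψ F + b := by
  have hZ := (wsum_one_pos J ψ).ne'
  unfold avg
  rw [div_eq_iff hZ, add_mul, mul_assoc, div_mul_cancel₀ _ hZ]
  unfold wsum
  rw [Finset.mul_sum, Finset.mul_sum, ← Finset.sum_add_distrib]
  exact Finset.sum_congr rfl fun σ _ => by ring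

/-! ### Global spin flip -/

omit [DecidableEq ι] in
/-- The pair interaction is even under the global flip. [folklore] -/
theorem pairEnergy_neg (J : ι → ι → ℝ) (σ : SpinConfig ι) : pairEnergy J (-σ) = pairEnergy J σ := by
  simp [pairEnergy, spinAt_neg]

omit [DecidableEq ι] in
/-- The field term is invariant under `(ψ, σ) ↦ (-ψ, -σ)`. [folklore] -/
theorem fieldEnergy_neg_neg (ψ : ι → ℝ) (σ : SpinConfig ι) : fieldEnergy (-ψ) (-σ) = fieldEnergy ψ σ := by
  simp [fieldEnergy, spinAt_neg]

omit [DecidableEq ι] in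
/-- The Gibbs weight is invariant under `(ψ, σ) ↦ (-ψ, -σ)`. [folklore] -/
theorem weight_neg_neg (J : ι → ι → ℝ) (ψ : ι → ℝ) (σ : SpinConfig ι) :
    weight J (-ψ) (-σ) = weight J ψ σ := by
  rw [weight, weight, pairEnergy_neg, fieldEnergy_neg_neg]

/-- **Global spin-flip symmetry**: `⟨σ_o⟩_{-ψ} = -⟨σ_o⟩_ψ` ("when `g ≡ 0`, `λ(g) = 0` by symmetry",
Ding–Song–Sun 2022, §2). [cite: DingSongSun2022, §2, after eq. (2.4)] -/
theorem avg_neg_field_spinAt (J : ι → ι → ℝ) (ψ : ι → ℝ) (o : ι) :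
    avg J (-ψ) (spinAt o) = -avg J ψ (spinAt o) := by
  unfold avg wsum
  have hZ : ∑ σ, weight J (-ψ) σ * 1 = ∑ σ, weight J ψ σ * 1 := by
    rw [← Equiv.sum_comp (Equiv.neg (SpinConfig ι))]
    exact Finset.sum_congr rfl fun σ _ => by rw [Equiv.neg_apply, weight_neg_neg]
  have hN : ∑ σ, weight J (-ψ) σ * spinAt o σ = -∑ σ, weight J ψ σ * spinAt o σ := by
    rw [← Equiv.sum_comp (Equiv.neg (SpinConfig ι)), ← Finset.sum_neg_distrib]
    exact Finset.sum_congr rfl fun σ _ => by rw [Equiv.neg_apply, weight_neg_neg, spinAt_neg]; ring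
  rw [hZ, hN, neg_div]

/-- Pinned form of the flip symmetry: `∑_{σ_v=-s} w_{-ψ} F = ∑_{σ_v = s} w_ψ F(-·)`. [folklore] -/
theorem pin_neg_weight_neg (J : ι → ι → ℝ) (ψ : ι → ℝ) (v : ι) (s : ℤˣ) (F : SpinConfig ι → ℝ) :
    pin v (-s) (fun σ => weight J (-ψ) σ * F σ) = pin v s (fun σ => weight J ψ σ * F (-σ)) := by
  unfold pin
  rw [← Equiv.sum_comp (Equiv.neg (SpinConfig ι))]
  refine Finset.sum_congr rfl fun σ _ => ?_
  simp only [Equiv.neg_apply, Pi.neg_apply, neg_inj, weight_neg_neg]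

/-! ### Changing the field at one vertex -/

/-- Changing the field at `v` changes the field term by `(t - ψ_v) σ_v`. [folklore] -/
theorem fieldEnergy_update (ψ : ι → ℝ) (v : ι) (t : ℝ) (σ : SpinConfig ι) :
    fieldEnergy (Function.update ψ v t) σ = fieldEnergy ψ σ + (t - ψ v) * spinAt v σ := by
  unfold fieldEnergy
  have h : ∑ i, Function.update ψ v t i * spinAt i σ - ∑ i, ψ i * spinAt i σ = (t - ψ v) * spinAt v σ := by
    rw [← Finset.sum_sub_distrib]
    rw [Finset.sum_eq_single v]
    · simp
      ring
    · intro u _ hu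
      rw [Function.update_of_ne hu, sub_self]
    · intro h; exact absurd (Finset.mem_univ v) h
  linarith

/-- Changing the field at `v` tilts the weight by `exp ((t - ψ_v) σ_v)`. [folklore] -/
theorem weight_update (J : ι → ι → ℝ) (ψ : ι → ℝ) (v : ι) (t : ℝ) (σ : SpinConfig ι) :
    weight J (Function.update ψ v t) σ = Real.exp ((t - ψ v) * spinAt v σ) * weight J ψ σ := by
  rw [weight, weight, fieldEnergy_update, ← Real.exp_add]
  congr 1
  ring

omit [Fintype ι] [DecidableEq ι] in
/-- On `{σ_v = s}` the spin at `v` is the real number `s`. [folklore] -/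
theorem spinAt_eq_of_pin {v : ι} {s : ℤˣ} {σ : SpinConfig ι} (h : σ v = s) :
    spinAt v σ = ((s : ℤ) : ℝ) := by
  simp [spinAt, h]

/-- On a pinned sum the tilt by the field at `v` is a constant factor. [folklore] -/
theorem pin_weight_update (J : ι → ι → ℝ) (ψ : ι → ℝ) (v : ι) (t : ℝ) (s : ℤˣ)
    (F : SpinConfig ι → ℝ) :
    pin v s (fun σ => weight J (Function.update ψ v t) σ * F σ) =
      Real.exp ((t - ψ v) * ((s : ℤ) : ℝ)) * pin v s (fun σ => weight J ψ σ * F σ) := by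
  have : (fun σ => weight J (Function.update ψ v t) σ * F σ) =
      fun σ => (fun u : ℤˣ => Real.exp ((t - ψ v) * ((u : ℤ) : ℝ))) (σ v) * (weight J ψ σ * F σ) := by
    funext σ
    rw [weight_update, mul_assoc]
    rfl
  rw [this]
  exact pin_mul_apply v s (fun u : ℤˣ => Real.exp ((t - ψ v) * ((u : ℤ) : ℝ)))
    (fun σ => weight J ψ σ * F σ)

/-- The odds of `σ_v` with the field at `v` switched off: `e^{2λ}` for the effective field `λ`
induced by the other spins (Ding–Song–Sun 2022, §2, eq. (2.4)). [cite: DingSongSun2022, §2, eq. (2.4)] -/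
def ratio (v : ι) (J : ι → ι → ℝ) (ψ : ι → ℝ) : ℝ :=
  pin v 1 (fun σ => weight J (Function.update ψ v 0) σ * 1) /
    pin v (-1) (fun σ => weight J (Function.update ψ v 0) σ * 1)

/-- The odds are positive. [folklore] -/
theorem ratio_pos (v : ι) (J : ι → ι → ℝ) (ψ : ι → ℝ) : 0 < ratio v J ψ :=
  div_pos (pin_pos v 1 fun σ => by rw [mul_one]; exact weight_pos _ _ σ)
    (pin_pos v (-1) fun σ => by rw [mul_one]; exact weight_pos _ _ σ)

/-- The odds depend on the field off `v` only. [cite: DingSongSun2022, §2, eq. (2.4)] -/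
theorem ratio_congr {v : ι} (J : ι → ι → ℝ) {ψ ψ' : ι → ℝ} (h : ∀ u, u ≠ v → ψ u = ψ' u) :
    ratio v J ψ = ratio v J ψ' := by
  have : Function.update ψ v 0 = Function.update ψ' v 0 := by
    funext u
    by_cases hu : u = v
    · subst hu; simp
    · rw [Function.update_of_ne hu, Function.update_of_ne hu, h u hu]
  rw [ratio, ratio, this]

/-- **The effective-field formula** (Ding–Song–Sun 2022, §2, eqs. (2.3)–(2.4)):
`⟨σ_v⟩_{ψ^{(v ↦ t)}} = tanh (λ + t)`, i.e. `th (e^{2λ} e^{2t})`. [cite: DingSongSun2022, §2, eqs. (2.3)–(2.4)] -/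
theorem avg_update_spinAt_self (J : ι → ι → ℝ) (ψ : ι → ℝ) (v : ι) (t : ℝ) :
    avg J (Function.update ψ v t) (spinAt v) = th (ratio v J ψ * Real.exp (2 * t)) := by
  unfold th
  have hup : Function.update ψ v t = Function.update (Function.update ψ v 0) v t := by
    rw [Function.update_idem]
  rw [hup, ratio]
  generalize hψ₀ : Function.update ψ v 0 = ψ₀
  have h0 : ψ₀ v = 0 := by rw [← hψ₀]; simp
  set P := pin v 1 (fun σ => weight J ψ₀ σ * 1) with hP
  set M := pin v (-1) (fun σ => weight J ψ₀ σ * 1) with hM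
  have hPpos : 0 < P := pin_pos v 1 fun σ => by rw [mul_one]; exact weight_pos _ _ σ
  have hMpos : 0 < M := pin_pos v (-1) fun σ => by rw [mul_one]; exact weight_pos _ _ σ
  have e1 : pin v 1 (fun σ => weight J ψ₀ σ * spinAt v σ) = P := by
    rw [hP]; unfold pin
    refine Finset.sum_congr rfl fun σ _ => ?_
    dsimp only
    split_ifs with h
    · rw [spinAt_eq_of_pin h]; simp
    · rfl
  have e2 : pin v (-1) (fun σ => weight J ψ₀ σ * spinAt v σ) = -M := by
    rw [hM]; unfold pin
    rw [← Finset.sum_neg_distrib]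
    refine Finset.sum_congr rfl fun σ _ => ?_
    dsimp only
    split_ifs with h
    · rw [spinAt_eq_of_pin h]; simp
    · simp
  have hZ : wsum J (Function.update ψ₀ v t) (fun _ => 1) = Real.exp t * P + Real.exp (-t) * M := by
    rw [wsum_eq_pin _ _ _ v, pin_weight_update J ψ₀ v t 1, pin_weight_update J ψ₀ v t (-1), h0]
    simp [hP, hM]
  have hN : wsum J (Function.update ψ₀ v t) (spinAt v) = Real.exp t * P - Real.exp (-t) * M := by
    rw [wsum_eq_pin _ _ _ v, pin_weight_update J ψ₀ v t 1, pin_weight_update J ψ₀ v t (-1), h0,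
      e1, e2]
    simp
    ring
  rw [avg, hZ, hN]
  have hexp : Real.exp (2 * t) = Real.exp t * Real.exp t := by rw [two_mul, Real.exp_add]
  rw [hexp, Real.exp_neg]
  have het : 0 < Real.exp t := Real.exp_pos t
  field_simp

/-! ### Decoupling a vertex (Ding–Song–Sun 2022, §1–§2: a spin frozen by an infinite field "has
the same effect as removing `u` from the graph and adding an extra field `±J_{uv}` to each
neighbour `v ∼ u`") -/

/-- The couplings with the vertex `v` decoupled. [cite: DingSongSun2022, §1, before Theorem 1.1] -/
def Jdec (v : ι) (J : ι → ι → ℝ) : ι → ι → ℝ := fun i j => if i = v ∨ j = v then 0 else J i j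

/-- The field induced on the other vertices by `σ_v = +1`: `k_u = J_{vu} + J_{uv}` (`k_v = 0`).
[cite: DingSongSun2022, §1, before Theorem 1.1] -/
def kvec (v : ι) (J : ι → ι → ℝ) : ι → ℝ := fun u => if u = v then 0 else J v u + J u v

omit [Fintype ι] in
/-- Decoupling preserves ferromagnetism. [folklore] -/
theorem Jdec_nonneg (v : ι) {J : ι → ι → ℝ} (hJ : ∀ i j, 0 ≤ J i j) : ∀ i j, 0 ≤ Jdec v J i j := by
  intro i j
  unfold Jdec
  split_ifs
  exacts [le_rfl, hJ i j]

omit [Fintype ι] in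
/-- The induced field of a ferromagnet is nonnegative (so `h + k ≥ 0` in the induction; Ding–Song–Sun 2022, §2: "changes `h_u` to `h_u + J_{uv}`"). [cite: DingSongSun2022, §2, after eq. (2.6)] -/
theorem kvec_nonneg (v : ι) {J : ι → ι → ℝ} (hJ : ∀ i j, 0 ≤ J i j) : ∀ u, 0 ≤ kvec v J u := by
  intro u
  unfold kvec
  split_ifs
  exacts [le_rfl, add_nonneg (hJ v u) (hJ u v)]

omit [Fintype ι] in
/-- No induced field at `v` itself. [folklore] -/
@[simp] theorem kvec_self (v : ι) (J : ι → ι → ℝ) : kvec v J v = 0 := by simp [kvec]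

omit [Fintype ι] in
/-- The induced field at `u ≠ v` is `J_{vu} + J_{uv}`. [folklore] -/
theorem kvec_of_ne (v : ι) (J : ι → ι → ℝ) {u : ι} (hu : u ≠ v) : kvec v J u = J v u + J u v := by
  simp [kvec, hu]

/-- `∑_i f i = f v + ∑_{i ≠ v} f i`. [folklore] -/
theorem sum_split (v : ι) (f : ι → ℝ) : ∑ i, f i = f v + ∑ i ∈ univ.erase v, f i :=
  (Finset.add_sum_erase _ _ (Finset.mem_univ v)).symm

/-- Expansion of the pair interaction around a vertex `v`. [folklore] -/
theorem pairEnergy_expand (J : ι → ι → ℝ) (v : ι) (σ : SpinConfig ι) :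
    pairEnergy J σ = J v v + spinAt v σ * ∑ j ∈ univ.erase v, (J v j + J j v) * spinAt j σ +
      ∑ i ∈ univ.erase v, ∑ j ∈ univ.erase v, J i j * (spinAt i σ * spinAt j σ) := by
  unfold pairEnergy
  rw [sum_split v]
  have h1 : ∑ j, J v j * (spinAt v σ * spinAt j σ) =
      J v v + ∑ j ∈ univ.erase v, J v j * (spinAt v σ * spinAt j σ) := by
    rw [sum_split v, spinAt_mul_self, mul_one]
  have h2 : ∑ i ∈ univ.erase v, ∑ j, J i j * (spinAt i σ * spinAt j σ) =
      ∑ i ∈ univ.erase v, J i v * (spinAt i σ * spinAt v σ) +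
        ∑ i ∈ univ.erase v, ∑ j ∈ univ.erase v, J i j * (spinAt i σ * spinAt j σ) := by
    rw [← Finset.sum_add_distrib]
    exact Finset.sum_congr rfl fun i _ => sum_split v _
  have h3 : ∑ i ∈ univ.erase v, J i v * (spinAt i σ * spinAt v σ) +
      ∑ j ∈ univ.erase v, J v j * (spinAt v σ * spinAt j σ) =
      spinAt v σ * ∑ j ∈ univ.erase v, (J v j + J j v) * spinAt j σ := by
    rw [Finset.mul_sum, ← Finset.sum_add_distrib]
    exact Finset.sum_congr rfl fun j _ => by ring
  rw [h1, h2, ← h3]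
  ring

/-- The decoupled interaction does not involve `v`. [folklore] -/
theorem pairEnergy_Jdec (J : ι → ι → ℝ) (v : ι) (σ : SpinConfig ι) :
    pairEnergy (Jdec v J) σ =
      ∑ i ∈ univ.erase v, ∑ j ∈ univ.erase v, J i j * (spinAt i σ * spinAt j σ) := by
  rw [pairEnergy_expand _ v]
  have h1 : Jdec v J v v = 0 := by simp [Jdec]
  have h2 : ∑ j ∈ univ.erase v, (Jdec v J v j + Jdec v J j v) * spinAt j σ = 0 :=
    Finset.sum_eq_zero fun j _ => by simp [Jdec]
  have h3 : ∑ i ∈ univ.erase v, ∑ j ∈ univ.erase v, Jdec v J i j * (spinAt i σ * spinAt j σ) =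
      ∑ i ∈ univ.erase v, ∑ j ∈ univ.erase v, J i j * (spinAt i σ * spinAt j σ) :=
    Finset.sum_congr rfl fun i hi => Finset.sum_congr rfl fun j hj => by
      rw [Finset.mem_erase] at hi hj
      simp [Jdec, hi.1, hj.1]
  rw [h1, h2, h3]
  ring

/-- The field term of the induced field. [folklore] -/
theorem fieldEnergy_kvec (J : ι → ι → ℝ) (v : ι) (σ : SpinConfig ι) :
    fieldEnergy (kvec v J) σ = ∑ j ∈ univ.erase v, (J v j + J j v) * spinAt j σ := by
  unfold fieldEnergy
  rw [sum_split v, kvec_self, zero_mul, zero_add]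
  exact Finset.sum_congr rfl fun j hj => by
    rw [Finset.mem_erase] at hj
    rw [kvec_of_ne v J hj.1]

/-- **Decoupling identity**: `∑ J σσ = ∑ J^{(v)} σσ + σ_v ∑_u k_u σ_u + J_{vv}`.
[cite: DingSongSun2022, §1, before Theorem 1.1] -/
theorem pairEnergy_decouple (J : ι → ι → ℝ) (v : ι) (σ : SpinConfig ι) :
    pairEnergy J σ = pairEnergy (Jdec v J) σ + spinAt v σ * fieldEnergy (kvec v J) σ + J v v := by
  rw [pairEnergy_expand J v, pairEnergy_Jdec, fieldEnergy_kvec]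
  ring

/-- The decoupled interaction is `v`-independent. [folklore] -/
theorem indepAt_pairEnergy_Jdec (J : ι → ι → ℝ) (v : ι) : IndepAt v (pairEnergy (Jdec v J)) := by
  intro σ s
  rw [pairEnergy_Jdec, pairEnergy_Jdec]
  refine Finset.sum_congr rfl fun i hi => Finset.sum_congr rfl fun j hj => ?_
  rw [Finset.mem_erase] at hi hj
  simp [spinAt, Function.update_of_ne hi.1, Function.update_of_ne hj.1]

/-- The part of the decoupled weight not involving `σ_v`. [folklore] -/
def rest (v : ι) (J : ι → ι → ℝ) (ψ : ι → ℝ) (σ : SpinConfig ι) : ℝ :=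
  Real.exp (pairEnergy (Jdec v J) σ + ∑ u ∈ univ.erase v, ψ u * spinAt u σ)

/-- `rest` is positive. [folklore] -/
theorem rest_pos (v : ι) (J : ι → ι → ℝ) (ψ : ι → ℝ) (σ : SpinConfig ι) : 0 < rest v J ψ σ :=
  Real.exp_pos _

/-- `rest` is `v`-independent. [folklore] -/
theorem indepAt_rest (v : ι) (J : ι → ι → ℝ) (ψ : ι → ℝ) : IndepAt v (rest v J ψ) := by
  intro σ s
  unfold rest
  rw [indepAt_pairEnergy_Jdec J v σ s]
  congr 2
  exact Finset.sum_congr rfl fun u hu => by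
    rw [Finset.mem_erase] at hu
    simp [spinAt, Function.update_of_ne hu.1]

/-- `rest` depends on the field off `v` only. [folklore] -/
theorem rest_congr (v : ι) (J : ι → ι → ℝ) {ψ ψ' : ι → ℝ} (h : ∀ u, u ≠ v → ψ u = ψ' u) :
    rest v J ψ = rest v J ψ' := by
  funext σ
  unfold rest
  congr 2
  exact Finset.sum_congr rfl fun u hu => by
    rw [Finset.mem_erase] at hu
    rw [h u hu.1]

/-- The decoupled weight factorises as `exp (ψ_v σ_v) · rest`. [folklore] -/
theorem weight_Jdec_eq (v : ι) (J : ι → ι → ℝ) (ψ : ι → ℝ) (σ : SpinConfig ι) :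
    weight (Jdec v J) ψ σ = Real.exp (ψ v * spinAt v σ) * rest v J ψ σ := by
  unfold weight rest fieldEnergy
  rw [sum_split v, ← Real.exp_add]
  congr 1
  ring

/-- Pinned sums of the decoupled weight: the factor `exp (ψ_v s)` comes out. [folklore] -/
theorem pin_weight_Jdec (v : ι) (J : ι → ι → ℝ) (ψ : ι → ℝ) (s : ℤˣ) (F : SpinConfig ι → ℝ) :
    pin v s (fun σ => weight (Jdec v J) ψ σ * F σ) =
      Real.exp (ψ v * ((s : ℤ) : ℝ)) * pin v s (fun σ => rest v J ψ σ * F σ) := by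
  have : (fun σ => weight (Jdec v J) ψ σ * F σ) =
      fun σ => (fun u : ℤˣ => Real.exp (ψ v * ((u : ℤ) : ℝ))) (σ v) * (rest v J ψ σ * F σ) := by
    funext σ
    rw [weight_Jdec_eq, mul_assoc]
    rfl
  rw [this]
  exact pin_mul_apply v s (fun u : ℤˣ => Real.exp (ψ v * ((u : ℤ) : ℝ))) (fun σ => rest v J ψ σ * F σ)

/-- In the decoupled system the expectation of an observable not involving `σ_v` is a pinned
average, for either pin. [folklore] -/
theorem avg_Jdec_eq_pin (v : ι) (J : ι → ι → ℝ) (ψ : ι → ℝ) {F : SpinConfig ι → ℝ}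
    (hF : IndepAt v F) (s : ℤˣ) :
    avg (Jdec v J) ψ F =
      pin v s (fun σ => rest v J ψ σ * F σ) / pin v s (fun σ => rest v J ψ σ * 1) := by
  have hR1 : IndepAt v (fun σ => rest v J ψ σ * 1) := (indepAt_rest v J ψ).mul (indepAt_const v 1)
  have hRF : IndepAt v (fun σ => rest v J ψ σ * F σ) := (indepAt_rest v J ψ).mul hF
  unfold avg
  rw [wsum_eq_pin _ _ _ v, wsum_eq_pin _ _ _ v]
  rw [pin_weight_Jdec, pin_weight_Jdec, pin_weight_Jdec, pin_weight_Jdec, hRF.pin_eq 1 s,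
    hRF.pin_eq (-1) s, hR1.pin_eq 1 s, hR1.pin_eq (-1) s, ← add_mul, ← add_mul]
  have hc : 0 < Real.exp (ψ v * (((1 : ℤˣ) : ℤ) : ℝ)) + Real.exp (ψ v * (((-1 : ℤˣ) : ℤ) : ℝ)) := by
    positivity
  rw [mul_div_mul_left _ _ hc.ne']

/-- In the decoupled system, observables not involving `σ_v` do not feel the field at `v`
("`⟨σ_o | σ_v = ±1⟩_h` does not depend on `h_v`", Ding–Song–Sun 2022, §2).
[cite: DingSongSun2022, §2, before eq. (2.6)] -/
theorem avg_Jdec_congr (v : ι) (J : ι → ι → ℝ) {ψ ψ' : ι → ℝ} (h : ∀ u, u ≠ v → ψ u = ψ' u)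
    {F : SpinConfig ι → ℝ} (hF : IndepAt v F) : avg (Jdec v J) ψ F = avg (Jdec v J) ψ' F := by
  rw [avg_Jdec_eq_pin v J ψ hF 1, avg_Jdec_eq_pin v J ψ' hF 1, rest_congr v J h]

/-- The weight of the full system on `{σ_v = s}` is the decoupled weight with the field shifted
by `s k`. [cite: DingSongSun2022, §1, before Theorem 1.1] -/
theorem weight_eq_of_pin (J : ι → ι → ℝ) (ψ : ι → ℝ) (v : ι) {s : ℤˣ} {σ : SpinConfig ι}
    (hσ : σ v = s) :
    weight J ψ σ = Real.exp (J v v + ψ v * ((s : ℤ) : ℝ)) *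
      rest v J (fun u => ψ u + ((s : ℤ) : ℝ) * kvec v J u) σ := by
  have hs : spinAt v σ = ((s : ℤ) : ℝ) := spinAt_eq_of_pin hσ
  have hsum : ∑ u ∈ univ.erase v, (ψ u + ((s : ℤ) : ℝ) * kvec v J u) * spinAt u σ =
      ∑ u ∈ univ.erase v, ψ u * spinAt u σ + ((s : ℤ) : ℝ) * fieldEnergy (kvec v J) σ := by
    rw [fieldEnergy_kvec, Finset.mul_sum, ← Finset.sum_add_distrib]
    exact Finset.sum_congr rfl fun u hu => by
      rw [Finset.mem_erase] at hu
      rw [kvec_of_ne v J hu.1]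
      ring
  unfold weight rest
  rw [hsum, pairEnergy_decouple J v, ← Real.exp_add, hs]
  congr 1
  unfold fieldEnergy
  rw [sum_split v (fun i => ψ i * spinAt i σ), hs]
  ring

/-- Pinned sums of the full weight in terms of the decoupled system (Ding–Song–Sun 2022, §1: the frozen spin acts as the field `±J_{uv}` on the neighbours). [cite: DingSongSun2022, §1, before Theorem 1.1] -/
theorem pin_weight_eq (J : ι → ι → ℝ) (ψ : ι → ℝ) (v : ι) (s : ℤˣ) (F : SpinConfig ι → ℝ) :
    pin v s (fun σ => weight J ψ σ * F σ) = Real.exp (J v v + ψ v * ((s : ℤ) : ℝ)) *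
      pin v s (fun σ => rest v J (fun u => ψ u + ((s : ℤ) : ℝ) * kvec v J u) σ * F σ) := by
  unfold pin
  rw [Finset.mul_sum]
  refine Finset.sum_congr rfl fun σ _ => ?_
  dsimp only
  split_ifs with h
  · rw [weight_eq_of_pin J ψ v h, mul_assoc]
  · rw [mul_zero]

/-- `pin_weight_eq` at `σ_v = +1`: the field becomes `ψ + k`. [cite: DingSongSun2022, §1, before Theorem 1.1] -/
theorem pin_one_weight (J : ι → ι → ℝ) (ψ : ι → ℝ) (v : ι) (F : SpinConfig ι → ℝ) :
    pin v 1 (fun σ => weight J ψ σ * F σ) =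
      Real.exp (J v v + ψ v) * pin v 1 (fun σ => rest v J (fun u => ψ u + kvec v J u) σ * F σ) := by
  rw [pin_weight_eq]
  have h1 : (fun u => ψ u + (((1 : ℤˣ) : ℤ) : ℝ) * kvec v J u) = fun u => ψ u + kvec v J u := by
    funext u; simp
  rw [h1]
  simp

/-- `pin_weight_eq` at `σ_v = -1`: the field becomes `ψ - k`. [cite: DingSongSun2022, §1, before Theorem 1.1] -/
theorem pin_neg_one_weight (J : ι → ι → ℝ) (ψ : ι → ℝ) (v : ι) (F : SpinConfig ι → ℝ) :
    pin v (-1) (fun σ => weight J ψ σ * F σ) =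
      Real.exp (J v v - ψ v) * pin v (-1) (fun σ => rest v J (fun u => ψ u - kvec v J u) σ * F σ) := by
  rw [pin_weight_eq]
  have h1 : (fun u => ψ u + (((-1 : ℤˣ) : ℤ) : ℝ) * kvec v J u) = fun u => ψ u - kvec v J u := by
    funext u; simp; ring
  rw [h1]
  simp [sub_eq_add_neg]

/-- A factor `σ_v` comes out of a pinned sum as the pin value. [folklore] -/
theorem pin_mul_spinAt_self (v : ι) (s : ℤˣ) (G : SpinConfig ι → ℝ) :
    pin v s (fun σ => G σ * spinAt v σ) = ((s : ℤ) : ℝ) * pin v s G := by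
  have : (fun σ => G σ * spinAt v σ) = fun σ => (fun u : ℤˣ => ((u : ℤ) : ℝ)) (σ v) * G σ := by
    funext σ; rw [mul_comm]; rfl
  rw [this]
  exact pin_mul_apply v s (fun u : ℤˣ => ((u : ℤ) : ℝ)) G

/-- **The decomposition over `σ_v`** (Ding–Song–Sun 2022, §2, eqs. (2.5) and (2.8)):
`⟨σ_o⟩_φ = ½(A + B) + ⟨σ_v⟩_φ · ½(A - B)`, where `A = ⟨σ_o | σ_v = +1⟩_φ` and
`B = ⟨σ_o | σ_v = -1⟩_φ` are the expectations in the decoupled system with fields `φ ± k`.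
[cite: DingSongSun2022, §2, eqs. (2.5), (2.8)] -/
theorem avg_decomp (J : ι → ι → ℝ) (φ : ι → ℝ) {o v : ι} (hov : o ≠ v) :
    avg J φ (spinAt o) =
      (avg (Jdec v J) (fun u => φ u + kvec v J u) (spinAt o) +
          avg (Jdec v J) (fun u => φ u - kvec v J u) (spinAt o)) / 2 +
        avg J φ (spinAt v) *
          ((avg (Jdec v J) (fun u => φ u + kvec v J u) (spinAt o) -
            avg (Jdec v J) (fun u => φ u - kvec v J u) (spinAt o)) / 2) := by
  have hFo : IndepAt v (spinAt o) := indepAt_spinAt hov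
  rw [avg_Jdec_eq_pin v J (fun u => φ u + kvec v J u) hFo 1,
    avg_Jdec_eq_pin v J (fun u => φ u - kvec v J u) hFo (-1)]
  unfold avg
  rw [wsum_eq_pin J φ (spinAt o) v, wsum_eq_pin J φ (fun _ => 1) v, wsum_eq_pin J φ (spinAt v) v]
  rw [pin_one_weight J φ v (spinAt o), pin_neg_one_weight J φ v (spinAt o),
    pin_one_weight J φ v (fun _ => 1), pin_neg_one_weight J φ v (fun _ => 1),
    pin_one_weight J φ v (spinAt v), pin_neg_one_weight J φ v (spinAt v),
    pin_mul_spinAt_self v 1, pin_mul_spinAt_self v (-1)]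
  have e1 : pin v 1 (fun σ => rest v J (fun u => φ u + kvec v J u) σ * (fun _ => (1 : ℝ)) σ) =
      pin v 1 (rest v J (fun u => φ u + kvec v J u)) := by
    congr 1; funext σ; simp
  have e2 : pin v (-1) (fun σ => rest v J (fun u => φ u - kvec v J u) σ * (fun _ => (1 : ℝ)) σ) =
      pin v (-1) (rest v J (fun u => φ u - kvec v J u)) := by
    congr 1; funext σ; simp
  simp only [e1, e2, Units.val_one, Units.val_neg, Int.cast_one, Int.cast_neg]
  have hRP : 0 < pin v 1 (rest v J (fun u => φ u + kvec v J u)) := pin_pos v 1 (rest_pos v J _)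
  have hRM : 0 < pin v (-1) (rest v J (fun u => φ u - kvec v J u)) := pin_pos v (-1) (rest_pos v J _)
  generalize pin v 1 (rest v J (fun u => φ u + kvec v J u)) = RP at hRP ⊢
  generalize pin v (-1) (rest v J (fun u => φ u - kvec v J u)) = RM at hRM ⊢
  generalize pin v 1 (fun σ => rest v J (fun u => φ u + kvec v J u) σ * spinAt o σ) = RPF
  generalize pin v (-1) (fun σ => rest v J (fun u => φ u - kvec v J u) σ * spinAt o σ) = RMF
  have he1 : 0 < Real.exp (J v v + φ v) := Real.exp_pos _
  have he2 : 0 < Real.exp (J v v - φ v) := Real.exp_pos _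
  generalize Real.exp (J v v + φ v) = eP at he1 ⊢
  generalize Real.exp (J v v - φ v) = eM at he2 ⊢
  field_simp
  ring

/-! ### The FKG inequality: monotonicity of expectations in the field -/

omit [DecidableEq ι] in
/-- **The FKG lattice condition** for ferromagnetic pair couplings `J ≥ 0` and any field.
[cite: FriedliVelenik2017, §3.8.3, eq. (3.53)] -/
theorem weight_mul_weight_le (J : ι → ι → ℝ) (hJ : ∀ i j, 0 ≤ J i j) (ψ : ι → ℝ)
    (σ σ' : SpinConfig ι) :
    weight J ψ σ * weight J ψ σ' ≤ weight J ψ (σ ⊓ σ') * weight J ψ (σ ⊔ σ') := by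
  rw [weight, weight, weight, weight, ← Real.exp_add, ← Real.exp_add]
  refine Real.exp_le_exp.2 ?_
  have hP : pairEnergy J σ + pairEnergy J σ' ≤ pairEnergy J (σ ⊓ σ') + pairEnergy J (σ ⊔ σ') := by
    unfold pairEnergy
    rw [← Finset.sum_add_distrib, ← Finset.sum_add_distrib]
    refine Finset.sum_le_sum fun i _ => ?_
    rw [← Finset.sum_add_distrib, ← Finset.sum_add_distrib]
    refine Finset.sum_le_sum fun j _ => ?_
    rw [← mul_add, ← mul_add]
    refine mul_le_mul_of_nonneg_left ?_ (hJ i j)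
    have := bondSpin_supermodular s(i, j) σ σ'
    simpa only [bondSpin_mk] using this
  have hF : fieldEnergy ψ σ + fieldEnergy ψ σ' = fieldEnergy ψ (σ ⊓ σ') + fieldEnergy ψ (σ ⊔ σ') := by
    unfold fieldEnergy
    rw [← Finset.sum_add_distrib, ← Finset.sum_add_distrib]
    refine Finset.sum_congr rfl fun i _ => ?_
    rw [← mul_add, ← mul_add, spinAt_add_modular]
  linarith

omit [DecidableEq ι] in
/-- A nonnegative field gives a nondecreasing field term. [folklore] -/
theorem fieldEnergy_mono {ψ : ι → ℝ} (hψ : ∀ i, 0 ≤ ψ i) : Monotone (fieldEnergy ψ) :=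
  fun _ _ h => Finset.sum_le_sum fun i _ => mul_le_mul_of_nonneg_left (spinAt_mono i h) (hψ i)

/-- **Monotonicity in the field** (FKG; Friedli–Velenik 2017, Thm. 3.21 / Lemma 3.31; used by
Ding–Song–Sun 2022, §2, for `c_± ≥ 0`: "both non-negative by the FKG inequality"): for `J ≥ 0`,
`ψ₁ ≤ ψ₂` and nondecreasing `F`, `⟨F⟩_{ψ₁} ≤ ⟨F⟩_{ψ₂}`. Proof: Mathlib's `fkg` on the distributive
lattice `{±1}^ι` with the tilt `e^{∑ (ψ₂-ψ₁) σ}`. [cite: DingSongSun2022, §2, after eq. (2.7)] -/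
theorem avg_mono_field (J : ι → ι → ℝ) (hJ : ∀ i j, 0 ≤ J i j) {ψ₁ ψ₂ : ι → ℝ}
    (hψ : ∀ i, ψ₁ i ≤ ψ₂ i) {F : SpinConfig ι → ℝ} (hF : Monotone F) :
    avg J ψ₁ F ≤ avg J ψ₂ F := by
  set C : ℝ := ∑ σ, |F σ| with hC
  have hF0 : 0 ≤ fun σ => F σ + C := fun σ => by
    have h1 : |F σ| ≤ C :=
      Finset.single_le_sum (f := fun σ => |F σ|) (fun _ _ => abs_nonneg _) (Finset.mem_univ σ)
    simp only [Pi.zero_apply]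
    linarith [neg_abs_le (F σ)]
  set R : SpinConfig ι → ℝ := fun σ => Real.exp (fieldEnergy (fun i => ψ₂ i - ψ₁ i) σ) with hR
  have hR0 : 0 ≤ R := fun σ => (Real.exp_pos _).le
  have hRmono : Monotone R := fun σ σ' h =>
    Real.exp_le_exp.2 (fieldEnergy_mono (fun i => sub_nonneg.2 (hψ i)) h)
  have hw0 : 0 ≤ weight J ψ₁ := fun σ => (weight_pos J ψ₁ σ).le
  have key := fkg (fun σ => F σ + C) R (weight J ψ₁) hw0 hF0 hR0 (hF.add_const C) hRmono
    (weight_mul_weight_le J hJ ψ₁)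
  have hw2 : ∀ σ, weight J ψ₂ σ = weight J ψ₁ σ * R σ := fun σ => by
    rw [hR]
    dsimp only
    rw [weight, weight, ← Real.exp_add]
    congr 1
    unfold fieldEnergy
    rw [add_assoc, ← Finset.sum_add_distrib]
    congr 1
    exact Finset.sum_congr rfl fun i _ => by ring
  have hZ1 := wsum_one_pos J ψ₁
  have hZ2 := wsum_one_pos J ψ₂
  have e1 : ∑ σ, weight J ψ₁ σ * R σ = wsum J ψ₂ (fun _ => 1) := by
    unfold wsum
    exact Finset.sum_congr rfl fun σ _ => by rw [hw2, mul_one]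
  have e2 : ∑ σ, weight J ψ₁ σ * ((F σ + C) * R σ) = wsum J ψ₂ (fun σ => F σ + C) := by
    unfold wsum
    exact Finset.sum_congr rfl fun σ _ => by rw [hw2]; ring
  have e3 : ∑ σ, weight J ψ₁ σ * (F σ + C) = wsum J ψ₁ (fun σ => F σ + C) := rfl
  have e4 : ∑ σ, weight J ψ₁ σ = wsum J ψ₁ (fun _ => 1) := by
    unfold wsum
    simp
  have key' : wsum J ψ₁ (fun σ => F σ + C) * wsum J ψ₂ (fun _ => 1) ≤
      wsum J ψ₁ (fun _ => 1) * wsum J ψ₂ (fun σ => F σ + C) := by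
    rw [← e1, ← e2, ← e3, ← e4]
    exact key
  have h1 : avg J ψ₁ (fun σ => F σ + C) ≤ avg J ψ₂ (fun σ => F σ + C) := by
    unfold avg
    rw [div_le_div_iff₀ hZ1 hZ2]
    linarith [key']
  have h2 : ∀ ψ, avg J ψ (fun σ => F σ + C) = avg J ψ F + C := fun ψ => by
    have := avg_affine J ψ F 1 C
    simp only [one_mul] at this
    exact this
  rw [h2, h2] at h1
  linarith

/-! ### The induction measure: active vertices and non-zero perturbation sites -/

open Classical in
/-- The vertices carrying a non-zero coupling. [folklore] -/
def supp (J : ι → ι → ℝ) : Finset ι := univ.filter fun i => ∃ j, J i j ≠ 0 ∨ J j i ≠ 0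

omit [DecidableEq ι] in
/-- Membership in `supp`. [folklore] -/
theorem mem_supp {J : ι → ι → ℝ} {i : ι} : i ∈ supp J ↔ ∃ j, J i j ≠ 0 ∨ J j i ≠ 0 := by
  simp [supp]

/-- Decoupling an uncoupled vertex does nothing. [folklore] -/
theorem Jdec_eq_self_of_not_mem {J : ι → ι → ℝ} {v : ι} (hv : v ∉ supp J) : Jdec v J = J := by
  rw [mem_supp] at hv
  push Not at hv
  funext i j
  unfold Jdec
  split_ifs with h
  · rcases h with rfl | rfl
    · exact ((hv j).1).symm
    · exact ((hv i).2).symm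
  · rfl

/-- Decoupling `v` removes `v` (at least) from the coupled vertices. [folklore] -/
theorem supp_Jdec_subset (J : ι → ι → ℝ) (v : ι) : supp (Jdec v J) ⊆ (supp J).erase v := by
  intro i hi
  rw [mem_supp] at hi
  obtain ⟨j, hj⟩ := hi
  rw [Finset.mem_erase, mem_supp]
  unfold Jdec at hj
  by_cases hiv : i = v
  · simp [hiv] at hj
  · by_cases hjv : j = v
    · simp [hiv, hjv] at hj
    · simp only [hiv, hjv, or_self, if_false] at hj
      exact ⟨hiv, j, hj⟩

/-- Decoupling a coupled vertex decreases the number of coupled vertices (`|V|` decreases in (†)). [cite: DingSongSun2022, §2, (†)] -/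
theorem card_supp_Jdec_lt {J : ι → ι → ℝ} {v : ι} (hv : v ∈ supp J) :
    (supp (Jdec v J)).card < (supp J).card :=
  lt_of_le_of_lt (Finset.card_le_card (supp_Jdec_subset J v))
    (Finset.card_erase_lt_of_mem hv)

open Classical in
/-- The sites where the perturbation `h` is switched on (`V_+` of Ding–Song–Sun 2022, §2).
[cite: DingSongSun2022, §2, proof of Theorem 1.1] -/
def onSites (h : ι → ℝ) : Finset ι := univ.filter fun u => h u ≠ 0

omit [DecidableEq ι] in
/-- Membership in `onSites`. [folklore] -/
theorem mem_onSites {h : ι → ℝ} {u : ι} : u ∈ onSites h ↔ h u ≠ 0 := by simp [onSites]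

/-- Resetting `h_v` to `0` removes `v` from `V_+`. [cite: DingSongSun2022, §2, (†)] -/
theorem onSites_update_zero {h : ι → ℝ} {v : ι} :
    onSites (Function.update h v 0) = (onSites h).erase v := by
  ext u
  rw [Finset.mem_erase, mem_onSites, mem_onSites]
  by_cases hu : u = v
  · subst hu; simp
  · simp [hu]

/-- Resetting a site of `V_+` decreases `|V_+|` (`m` decreases in (†)). [cite: DingSongSun2022, §2, (†)] -/
theorem card_onSites_update_lt {h : ι → ℝ} {v : ι} (hv : h v ≠ 0) :
    (onSites (Function.update h v 0)).card < (onSites h).card := by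
  rw [onSites_update_zero]
  exact Finset.card_erase_lt_of_mem (mem_onSites.2 hv)

omit [DecidableEq ι] in
/-- `|V_+| ≤ |V|`. [folklore] -/
theorem card_onSites_le (h : ι → ℝ) : (onSites h).card ≤ Fintype.card ι :=
  Finset.card_le_univ _

/-- The induction measure, a linearisation of the lexicographic order on `(|V|, |V_+|)` of
Ding–Song–Sun 2022, §2 (`|V|` replaced by the number of coupled vertices, since decoupled vertices
stay in the index type). [cite: DingSongSun2022, §2, proof of Theorem 1.1, (†)] -/
def measure (J : ι → ι → ℝ) (h : ι → ℝ) : ℕ :=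
  (supp J).card * (Fintype.card ι + 1) + (onSites h).card

/-- The measure decreases when a perturbed site is reset (`(n, m-1) < (n, m)`). [cite: DingSongSun2022, §2, (†)] -/
theorem measure_update_lt (J : ι → ι → ℝ) {h : ι → ℝ} {v : ι} (hv : h v ≠ 0) :
    measure J (Function.update h v 0) < measure J h := by
  unfold measure
  have := card_onSites_update_lt hv
  omega

/-- The measure decreases when a coupled vertex is decoupled, whatever happens to `V_+` (`(n-1, i) < (n, m)` for all `i`). [cite: DingSongSun2022, §2, (†)] -/
theorem measure_Jdec_lt {J : ι → ι → ℝ} {v : ι} (hv : v ∈ supp J) (h h' : ι → ℝ) :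
    measure (Jdec v J) h' < measure J h := by
  unfold measure
  have h1 := card_supp_Jdec_lt hv
  have h2 := card_onSites_le h'
  have h3 : (supp (Jdec v J)).card + 1 ≤ (supp J).card := h1
  calc (supp (Jdec v J)).card * (Fintype.card ι + 1) + (onSites h').card
      < ((supp (Jdec v J)).card + 1) * (Fintype.card ι + 1) := by nlinarith
    _ ≤ (supp J).card * (Fintype.card ι + 1) := Nat.mul_le_mul_right _ h3
    _ ≤ (supp J).card * (Fintype.card ι + 1) + (onSites h).card := Nat.le_add_right _ _


/-! ### The induction step (Ding–Song–Sun 2022, §2: (†) via Lemma 2.1) -/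

omit [Fintype ι] [DecidableEq ι] in
/-- Pointwise-equal fields give the same expectation. [folklore] -/
theorem avg_congr_field (J : ι → ι → ℝ) {ψ ψ' : ι → ℝ} (h : ∀ u, ψ u = ψ' u) (F : SpinConfig ι → ℝ)
    [Fintype ι] [DecidableEq ι] : avg J ψ F = avg J ψ' F := by
  rw [show ψ = ψ' from funext h]

/-- `c_± ≥ 0`: conditioning on `σ_v = +1` raises `⟨σ_o⟩` relative to `σ_v = -1` ("both non-negative
by the FKG inequality", Ding–Song–Sun 2022, §2, after eq. (2.7)). [cite: DingSongSun2022, §2, after eq. (2.7)] -/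
theorem avg_Jdec_sub_le_add (J : ι → ι → ℝ) (hJ : ∀ i j, 0 ≤ J i j) (φ : ι → ℝ) (v o : ι) :
    avg (Jdec v J) (fun u => φ u - kvec v J u) (spinAt o) ≤
      avg (Jdec v J) (fun u => φ u + kvec v J u) (spinAt o) :=
  avg_mono_field (Jdec v J) (Jdec_nonneg v hJ)
    (fun u => by linarith [kvec_nonneg v hJ u]) (spinAt_mono o)

/-- **The induction step of Ding–Song–Sun 2022, Theorem 1.1** (§2, (†), case `V_+ ≠ {o}`): given a
vertex `v ≠ o` with `h_v > 0`, the inequality (1.3) for `(J, g, h, o)` follows from (a) the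
instances with the field at `v` set to a common value `H` and `h_v` reset to `0` (eq. (2.6), first
line), (b) the instance for the decoupled system with `h` increased by the couplings of `v`
(eq. (2.6), second line: `σ_v = ±1` frozen), and (c) the instance observed at `v` with `h_v` reset
to `0` (eq. (2.12)), through the decomposition (2.8), Lemma 2.1 and the mixture identity (2.7).
[cite: DingSongSun2022, §2, proof of Theorem 1.1 ((†), eqs. (2.5)–(2.12)) and Lemma 2.1] -/
theorem main_step (J : ι → ι → ℝ) (hJ : ∀ i j, 0 ≤ J i j) (g h : ι → ℝ) {o v : ι} (hov : o ≠ v)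
    (hv : 0 < h v)
    (iha : ∀ H : ℝ,
      avg J (Function.update (fun u => g u + h u) v H) (spinAt o) -
          avg J (Function.update (fun u => g u - h u) v H) (spinAt o) ≤
        avg J (Function.update h v 0) (spinAt o) -
          avg J (fun u => -Function.update h v 0 u) (spinAt o))
    (ihb : avg (Jdec v J) (fun u => g u + (h u + kvec v J u)) (spinAt o) -
          avg (Jdec v J) (fun u => g u - (h u + kvec v J u)) (spinAt o) ≤
        avg (Jdec v J) (fun u => h u + kvec v J u) (spinAt o) -
          avg (Jdec v J) (fun u => -(h u + kvec v J u)) (spinAt o))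
    (ihc : avg J (Function.update (fun u => g u + h u) v (g v)) (spinAt v) -
          avg J (Function.update (fun u => g u - h u) v (g v)) (spinAt v) ≤
        avg J (Function.update h v 0) (spinAt v) -
          avg J (fun u => -Function.update h v 0 u) (spinAt v)) :
    avg J (fun u => g u + h u) (spinAt o) - avg J (fun u => g u - h u) (spinAt o) ≤
      avg J h (spinAt o) - avg J (fun u => -h u) (spinAt o) := by
  set φp : ι → ℝ := fun u => g u + h u with hφp
  set φm : ι → ℝ := fun u => g u - h u with hφm
  set h0 : ι → ℝ := Function.update h v 0 with hh0
  have hFo : IndepAt v (spinAt o) := indepAt_spinAt hov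
  have h00 : h0 v = 0 := by simp [hh0]
  have h0_of_ne : ∀ u, u ≠ v → h0 u = h u := fun u hu => by simp [hh0, Function.update_of_ne hu]
  /- the decompositions (2.8) -/
  have Dp := avg_decomp J φp hov (v := v)
  have Dm := avg_decomp J φm hov (v := v)
  have D0 := avg_decomp J h hov (v := v)
  have D00 := avg_decomp J h0 hov (v := v)
  have D' := avg_decomp J (fun u => -h u) hov (v := v)
  have D'0 := avg_decomp J (fun u => -h0 u) hov (v := v)
  -- the conditional expectations do not see the field at `v`
  have eA00 : avg (Jdec v J) (fun u => h0 u + kvec v J u) (spinAt o) =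
      avg (Jdec v J) (fun u => h u + kvec v J u) (spinAt o) :=
    avg_Jdec_congr v J (fun u hu => by rw [h0_of_ne u hu]) hFo
  have eB00 : avg (Jdec v J) (fun u => h0 u - kvec v J u) (spinAt o) =
      avg (Jdec v J) (fun u => h u - kvec v J u) (spinAt o) :=
    avg_Jdec_congr v J (fun u hu => by rw [h0_of_ne u hu]) hFo
  have eA'0 : avg (Jdec v J) (fun u => -h0 u + kvec v J u) (spinAt o) =
      avg (Jdec v J) (fun u => -h u + kvec v J u) (spinAt o) :=
    avg_Jdec_congr v J (fun u hu => by rw [h0_of_ne u hu]) hFo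
  have eB'0 : avg (Jdec v J) (fun u => -h0 u - kvec v J u) (spinAt o) =
      avg (Jdec v J) (fun u => -h u - kvec v J u) (spinAt o) :=
    avg_Jdec_congr v J (fun u hu => by rw [h0_of_ne u hu]) hFo
  rw [eA00, eB00] at D00
  rw [eA'0, eB'0] at D'0
  /- symmetry: `⟨σ_v⟩_{-ψ} = -⟨σ_v⟩_ψ` -/
  have Smh : avg J (fun u => -h u) (spinAt v) = -avg J h (spinAt v) := avg_neg_field_spinAt J h v
  have Stz : avg J (fun u => -h0 u) (spinAt v) = -avg J h0 (spinAt v) := avg_neg_field_spinAt J h0 v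
  /- effective fields (2.3)–(2.4), (2.10): everything through `th` -/
  have hexp2 : ∀ x y : ℝ, Real.exp (2 * (x + y)) = Real.exp (2 * x) * Real.exp (2 * y) := by
    intro x y; rw [mul_add, Real.exp_add]
  set c : ℝ := th (Real.exp (2 * h v)) with hc
  have hc0 : 0 ≤ c := th_nonneg (Real.one_le_exp (by linarith))
  have hc1 : c < 1 := th_lt_one (Real.exp_pos _)
  -- `a = tanh x`, `m₊ = tanh (x + h_v)`
  set a : ℝ := th (ratio v J φp * Real.exp (2 * g v)) with ha
  have hapos : 0 < ratio v J φp * Real.exp (2 * g v) := mul_pos (ratio_pos _ _ _) (Real.exp_pos _)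
  have ha_lt : a < 1 := th_lt_one hapos
  have ha_gt : -1 < a := neg_one_lt_th hapos
  have ha_eq : avg J (Function.update φp v (g v)) (spinAt v) = a := by
    rw [avg_update_spinAt_self]
  have hmp : avg J φp (spinAt v) = (a + c) / (1 + a * c) := by
    conv_lhs => rw [← Function.update_eq_self v φp]
    rw [avg_update_spinAt_self, show φp v = g v + h v from rfl, hexp2, ← mul_assoc,
      th_mul hapos (Real.exp_pos _)]
  have hmpH : ∀ H : ℝ, avg J (Function.update φp v H) (spinAt v) =
      (a + th (Real.exp (2 * (H - g v)))) / (1 + a * th (Real.exp (2 * (H - g v)))) := by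
    intro H
    rw [avg_update_spinAt_self, show H = g v + (H - g v) by ring, hexp2, ← mul_assoc,
      th_mul hapos (Real.exp_pos _), show g v + (H - g v) - g v = H - g v by ring]
  -- `b = tanh y`, `m₋ = tanh (y - h_v)`
  set b : ℝ := th (ratio v J φm * Real.exp (2 * g v)) with hb
  have hbpos : 0 < ratio v J φm * Real.exp (2 * g v) := mul_pos (ratio_pos _ _ _) (Real.exp_pos _)
  have hb_lt : b < 1 := th_lt_one hbpos
  have hb_gt : -1 < b := neg_one_lt_th hbpos
  have hb_eq : avg J (Function.update φm v (g v)) (spinAt v) = b := by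
    rw [avg_update_spinAt_self]
  have hmm : avg J φm (spinAt v) = (b - c) / (1 - b * c) := by
    conv_lhs => rw [← Function.update_eq_self v φm]
    rw [avg_update_spinAt_self, show φm v = g v + -h v from by simp [hφm]; ring, hexp2, ← mul_assoc,
      th_mul hbpos (Real.exp_pos _), show (2 : ℝ) * -h v = -(2 * h v) by ring, Real.exp_neg,
      th_inv (Real.exp_pos _)]
    rw [← hc]
    ring
  have hmmH : ∀ H : ℝ, avg J (Function.update φm v H) (spinAt v) =
      (b + th (Real.exp (2 * (H - g v)))) / (1 + b * th (Real.exp (2 * (H - g v)))) := by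
    intro H
    rw [avg_update_spinAt_self, show H = g v + (H - g v) by ring, hexp2, ← mul_assoc,
      th_mul hbpos (Real.exp_pos _), show g v + (H - g v) - g v = H - g v by ring]
  -- `t = tanh z`, `⟨σ_v⟩_h = tanh (z + h_v)`
  set t : ℝ := th (ratio v J h) with ht
  have ht_lt : t < 1 := th_lt_one (ratio_pos _ _ _)
  have ht_gt : -1 < t := neg_one_lt_th (ratio_pos _ _ _)
  have htz : avg J h0 (spinAt v) = t := by
    rw [hh0, avg_update_spinAt_self, mul_zero, Real.exp_zero, mul_one]
  have hmh : avg J h (spinAt v) = (t + c) / (1 + t * c) := by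
    conv_lhs => rw [← Function.update_eq_self v h]
    rw [avg_update_spinAt_self, th_mul (ratio_pos _ _ _) (Real.exp_pos _)]
  -- `α` of (2.7)/(2.11)
  have hct : 0 ≤ c * (t + 1) := mul_nonneg hc0 (by linarith)
  have htc : 0 < 1 + t * c := by linarith
  set α : ℝ := (1 - c) / (1 + t * c) with hα
  have hα0 : 0 ≤ α := div_nonneg (by linarith) htc.le
  have hα1 : α ≤ 1 := by
    rw [hα, div_le_one htc]; linarith
  have hmhα : avg J h (spinAt v) = 1 - α + α * t := by
    rw [hmh, hα]; field_simp; ring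
  -- the induction hypothesis (c): `tanh x - tanh y ≤ 2 tanh z` (2.12)
  have hab : a - b ≤ 2 * t := by
    have := ihc
    rw [ha_eq, hb_eq, htz, Stz, htz] at this
    linarith
  -- `c_± ≥ 0` by FKG
  have hcp : 0 ≤ (avg (Jdec v J) (fun u => φp u + kvec v J u) (spinAt o) -
      avg (Jdec v J) (fun u => φp u - kvec v J u) (spinAt o)) / 2 := by
    linarith [avg_Jdec_sub_le_add J hJ φp v o]
  have hcm : 0 ≤ (avg (Jdec v J) (fun u => φm u + kvec v J u) (spinAt o) -
      avg (Jdec v J) (fun u => φm u - kvec v J u) (spinAt o)) / 2 := by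
    linarith [avg_Jdec_sub_le_add J hJ φm v o]
  /- Lemma 2.1 -/
  obtain ⟨d, hd, hd', L21⟩ := scalar_lemma21 ha_gt ha_lt hb_gt hb_lt hc0 hc1 ht_gt hab hα hcp hcm
  -- the field value `H` with `tanh (H - g_v) = d`
  set H : ℝ := g v + Real.log ((1 + d) / (1 - d)) / 2 with hH
  have hdH : th (Real.exp (2 * (H - g v))) = d := by
    rw [hH, show 2 * (g v + Real.log ((1 + d) / (1 - d)) / 2 - g v) = Real.log ((1 + d) / (1 - d)) by ring,
      Real.exp_log (div_pos (by linarith) (by linarith)), th_ratio hd']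
  have hmpH' := hmpH H
  have hmmH' := hmmH H
  rw [hdH] at hmpH' hmmH'
  rw [← hmp, ← hmm, ← hmpH', ← hmmH'] at L21
  /- the decompositions of the `H`-systems have the same conditional expectations -/
  have DpH := avg_decomp J (Function.update φp v H) hov (v := v)
  have DmH := avg_decomp J (Function.update φm v H) hov (v := v)
  have eApH : avg (Jdec v J) (fun u => Function.update φp v H u + kvec v J u) (spinAt o) =
      avg (Jdec v J) (fun u => φp u + kvec v J u) (spinAt o) :=
    avg_Jdec_congr v J (fun u hu => by rw [Function.update_of_ne hu]) hFo
  have eBpH : avg (Jdec v J) (fun u => Function.update φp v H u - kvec v J u) (spinAt o) =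
      avg (Jdec v J) (fun u => φp u - kvec v J u) (spinAt o) :=
    avg_Jdec_congr v J (fun u hu => by rw [Function.update_of_ne hu]) hFo
  have eAmH : avg (Jdec v J) (fun u => Function.update φm v H u + kvec v J u) (spinAt o) =
      avg (Jdec v J) (fun u => φm u + kvec v J u) (spinAt o) :=
    avg_Jdec_congr v J (fun u hu => by rw [Function.update_of_ne hu]) hFo
  have eBmH : avg (Jdec v J) (fun u => Function.update φm v H u - kvec v J u) (spinAt o) =
      avg (Jdec v J) (fun u => φm u - kvec v J u) (spinAt o) :=
    avg_Jdec_congr v J (fun u hu => by rw [Function.update_of_ne hu]) hFo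
  rw [eApH, eBpH] at DpH
  rw [eAmH, eBmH] at DmH
  /- the induction hypothesis (b), with its fields identified -/
  have eAp : avg (Jdec v J) (fun u => g u + (h u + kvec v J u)) (spinAt o) =
      avg (Jdec v J) (fun u => φp u + kvec v J u) (spinAt o) :=
    avg_congr_field _ (fun u => by simp [hφp]; ring) _
  have eBm : avg (Jdec v J) (fun u => g u - (h u + kvec v J u)) (spinAt o) =
      avg (Jdec v J) (fun u => φm u - kvec v J u) (spinAt o) :=
    avg_congr_field _ (fun u => by simp [hφm]; ring) _
  have eB' : avg (Jdec v J) (fun u => -(h u + kvec v J u)) (spinAt o) =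
      avg (Jdec v J) (fun u => -h u - kvec v J u) (spinAt o) :=
    avg_congr_field _ (fun u => by ring) _
  rw [eAp, eBm, eB'] at ihb
  have ihaH := iha H
  /- assembly: (2.6)–(2.8) and the mixture identity (2.7) -/
  rw [htz] at D00
  rw [Stz, htz] at D'0
  rw [hmhα] at D0
  rw [Smh, hmhα] at D'
  have hD00α := congrArg (fun x => α * x) D00
  have hD'0α := congrArg (fun x => α * x) D'0
  have hDpHα := congrArg (fun x => α * x) DpH
  have hDmHα := congrArg (fun x => α * x) DmH
  have hiha := mul_le_mul_of_nonneg_left ihaH hα0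
  have hihb := mul_le_mul_of_nonneg_left ihb (sub_nonneg.2 hα1)
  linarith only [Dp, Dm, D0, D', hD00α, hD'0α, hDpHα, hDmHα, hiha, hihb, L21]

/-! ### The case `V_+ ⊆ {o}` and the induction (Ding–Song–Sun 2022, §2) -/

/-- With no field off `o`, the odds of `σ_o` at zero field are `1` by the spin-flip symmetry
("when `g ≡ 0`, `λ(g) = 0` by symmetry", Ding–Song–Sun 2022, §2). [cite: DingSongSun2022, §2, after eq. (2.4)] -/
theorem ratio_eq_one_of_off (J : ι → ι → ℝ) {h : ι → ℝ} {o : ι} (hoff : ∀ u, u ≠ o → h u = 0) :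
    ratio o J h = 1 := by
  have hz : Function.update h o 0 = (0 : ι → ℝ) := by
    funext u
    by_cases hu : u = o
    · subst hu; simp
    · rw [Function.update_of_ne hu, hoff u hu]; rfl
  have hsym := pin_neg_weight_neg J (0 : ι → ℝ) o 1 (fun _ => (1 : ℝ))
  rw [neg_zero] at hsym
  rw [ratio, hz, hsym]
  exact div_self (pin_pos o 1 fun σ => by rw [mul_one]; exact weight_pos _ _ σ).ne'

/-- **The case `V_+ ⊆ {o}`** (Ding–Song–Sun 2022, §2, eqs. (2.3)–(2.4) and the one-spin
inequality (2.2)): `⟨σ_o⟩_{g±h} = tanh (λ(g) + g_o ± h_o)` and `⟨σ_o⟩_{±h} = tanh (±h_o)`.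
[cite: DingSongSun2022, §2, eqs. (2.2)–(2.4)] -/
theorem one_spin_case (J : ι → ι → ℝ) (g h : ι → ℝ) (o : ι) (ho : 0 ≤ h o)
    (hoff : ∀ u, u ≠ o → h u = 0) :
    avg J (fun u => g u + h u) (spinAt o) - avg J (fun u => g u - h u) (spinAt o) ≤
      avg J h (spinAt o) - avg J (fun u => -h u) (spinAt o) := by
  have e1 : avg J (fun u => g u + h u) (spinAt o) =
      th (ratio o J (fun u => g u + h u) * Real.exp (2 * (g o + h o))) := by
    conv_lhs => rw [← Function.update_eq_self o (fun u => g u + h u)]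
    rw [avg_update_spinAt_self]
  have e2 : avg J (fun u => g u - h u) (spinAt o) =
      th (ratio o J (fun u => g u + h u) * Real.exp (2 * (g o - h o))) := by
    conv_lhs => rw [← Function.update_eq_self o (fun u => g u - h u)]
    rw [avg_update_spinAt_self,
      ratio_congr J (ψ' := fun u => g u + h u) (fun u hu => by simp [hoff u hu])]
  have r1 : ratio o J h = 1 := ratio_eq_one_of_off J hoff
  have r2 : ratio o J (fun u => -h u) = 1 := by
    rw [ratio_congr J (ψ' := h) (fun u hu => by simp [hoff u hu]), r1]
  have e3 : avg J h (spinAt o) = th (Real.exp (2 * h o)) := by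
    conv_lhs => rw [← Function.update_eq_self o h]
    rw [avg_update_spinAt_self, r1, one_mul]
  have e4 : avg J (fun u => -h u) (spinAt o) = th (Real.exp (2 * h o))⁻¹ := by
    conv_lhs => rw [← Function.update_eq_self o (fun u => -h u)]
    rw [avg_update_spinAt_self, r2, one_mul, ← Real.exp_neg]
    congr 1
    ring_nf
  rw [e1, e2, e3, e4, show 2 * (g o + h o) = 2 * g o + 2 * h o by ring,
    show 2 * (g o - h o) = 2 * g o + -(2 * h o) by ring, Real.exp_add, Real.exp_add, Real.exp_neg,
    ← mul_assoc, ← mul_assoc]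
  exact th_one_spin (mul_pos (ratio_pos _ _ _) (Real.exp_pos _)) (Real.one_le_exp (by linarith))

/-- **Theorem 1.1 of Ding–Song–Sun 2022 for general ferromagnetic pair couplings**: for `J ≥ 0`,
any field `g`, any `h ≥ 0` and any vertex `o`,
`⟨σ_o⟩_{g+h} - ⟨σ_o⟩_{g-h} ≤ ⟨σ_o⟩_h - ⟨σ_o⟩_{-h}`. Proof: the induction (†) of §2 on the measure
`measure J h` — the cases `h ≡ 0`, `V_+ ⊆ {o}` (`one_spin_case`), an uncoupled perturbed vertex
(drop its perturbation), and `main_step`. [cite: DingSongSun2022, Theorem 1.1 and §2] -/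
theorem pair_signedFieldDomination (J : ι → ι → ℝ) (hJ : ∀ i j, 0 ≤ J i j) (g h : ι → ℝ)
    (hh : ∀ u, 0 ≤ h u) (o : ι) :
    avg J (fun u => g u + h u) (spinAt o) - avg J (fun u => g u - h u) (spinAt o) ≤
      avg J h (spinAt o) - avg J (fun u => -h u) (spinAt o) := by
  suffices key : ∀ (N : ℕ) (J : ι → ι → ℝ) (g h : ι → ℝ) (o : ι), (∀ i j, 0 ≤ J i j) →
      (∀ u, 0 ≤ h u) → measure J h ≤ N →
      avg J (fun u => g u + h u) (spinAt o) - avg J (fun u => g u - h u) (spinAt o) ≤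
        avg J h (spinAt o) - avg J (fun u => -h u) (spinAt o) from
    key _ J g h o hJ hh le_rfl
  intro N
  induction N using Nat.strong_induction_on with
  | _ N ih =>
  intro J g h o hJ hh hN
  by_cases hzero : ∀ u, h u = 0
  · -- `h ≡ 0`: both sides vanish
    have e1 : (fun u => g u + h u) = fun u => g u - h u := by funext u; simp [hzero u]
    have e2 : (fun u => -h u) = h := by funext u; simp [hzero u]
    rw [e1, e2, sub_self, sub_self]
  by_cases hsupp : ∀ u, u ≠ o → h u = 0
  · exact one_spin_case J g h o (hh o) hsupp
  push Not at hsupp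
  obtain ⟨v, hvo, hvne⟩ := hsupp
  have hov : o ≠ v := fun e => hvo e.symm
  have hv : 0 < h v := lt_of_le_of_ne (hh v) (Ne.symm hvne)
  have hh0 : ∀ u, 0 ≤ Function.update h v 0 u := fun u => by
    by_cases hu : u = v
    · subst hu; simp
    · rw [Function.update_of_ne hu]; exact hh u
  have hlt0 : measure J (Function.update h v 0) < N := lt_of_lt_of_le (measure_update_lt J hvne) hN
  by_cases hvs : v ∈ supp J
  · -- the induction step (†)
    refine main_step J hJ g h hov hv ?_ ?_ ?_
    · intro H
      have := ih _ hlt0 J (Function.update g v H) (Function.update h v 0) o hJ hh0 le_rfl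
      rw [avg_congr_field J (ψ' := Function.update (fun u => g u + h u) v H) (fun u => by
          by_cases hu : u = v
          · subst hu; simp
          · simp [Function.update_of_ne hu]) (spinAt o),
        avg_congr_field J (ψ := fun u => Function.update g v H u - Function.update h v 0 u)
          (ψ' := Function.update (fun u => g u - h u) v H) (fun u => by
          by_cases hu : u = v
          · subst hu; simp
          · simp [Function.update_of_ne hu]) (spinAt o)] at this
      exact this
    · have hlt : measure (Jdec v J) (fun u => h u + kvec v J u) < N :=
        lt_of_lt_of_le (measure_Jdec_lt hvs h _) hN
      exact ih _ hlt (Jdec v J) g (fun u => h u + kvec v J u) o (Jdec_nonneg v hJ)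
        (fun u => add_nonneg (hh u) (kvec_nonneg v hJ u)) le_rfl
    · have := ih _ hlt0 J g (Function.update h v 0) v hJ hh0 le_rfl
      rw [avg_congr_field J (ψ' := Function.update (fun u => g u + h u) v (g v)) (fun u => by
          by_cases hu : u = v
          · subst hu; simp
          · simp [Function.update_of_ne hu]) (spinAt v),
        avg_congr_field J (ψ := fun u => g u - Function.update h v 0 u)
          (ψ' := Function.update (fun u => g u - h u) v (g v)) (fun u => by
          by_cases hu : u = v
          · subst hu; simp
          · simp [Function.update_of_ne hu]) (spinAt v)] at this
      exact this
  · -- `v` carries no coupling: nothing depends on the field at `v`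
    have hJd : Jdec v J = J := Jdec_eq_self_of_not_mem hvs
    have iso : ∀ ψ ψ' : ι → ℝ, (∀ u, u ≠ v → ψ u = ψ' u) →
        avg J ψ (spinAt o) = avg J ψ' (spinAt o) := fun ψ ψ' hψ => by
      have := avg_Jdec_congr v J hψ (indepAt_spinAt hov)
      rwa [hJd] at this
    have := ih _ hlt0 J g (Function.update h v 0) o hJ hh0 le_rfl
    rw [iso (fun u => g u + Function.update h v 0 u) (fun u => g u + h u) (fun u hu => by
        simp [Function.update_of_ne hu]),
      iso (fun u => g u - Function.update h v 0 u) (fun u => g u - h u) (fun u hu => by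
        simp [Function.update_of_ne hu]),
      iso (Function.update h v 0) h (fun u hu => by simp [Function.update_of_ne hu]),
      iso (fun u => -Function.update h v 0 u) (fun u => -h u) (fun u hu => by
        simp [Function.update_of_ne hu])] at this
    exact this

/-! ### The bridge: the tree's finite-volume model `fieldExpect G Λ β h bc` as a pair model on `↥Λ` -/

section Bridge

variable {V : Type*} [DecidableEq V] (G : SimpleGraph V) [G.LocallyFinite]

open Classical in
/-- **Double counting**: `∑_{e ∈ ℰ_Λ} σ_e = ½ ∑_{x ∈ Λ} ∑_{y ∈ Λ} 1_{x ∼ y} σ_x σ_y` (each edge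
inside `Λ` is an unordered pair of two ordered ones). [folklore] -/
theorem sum_edgesIn_bondSpin_eq_half (Λ : Finset V) (σ : SpinConfig V) :
    ∑ e ∈ edgesIn G Λ, bondSpin σ e =
      (1 / 2) * ∑ x ∈ Λ, ∑ y ∈ Λ, if G.Adj x y then spinAt x σ * spinAt y σ else 0 := by
  set D := (Λ ×ˢ Λ).filter (fun p : V × V => G.Adj p.1 p.2) with hD
  have h1 : ∑ p ∈ D, bondSpin σ s(p.1, p.2) =
      ∑ x ∈ Λ, ∑ y ∈ Λ, if G.Adj x y then spinAt x σ * spinAt y σ else 0 := by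
    rw [hD, Finset.sum_filter, Finset.sum_product]
    rfl
  have hmaps : ∀ p ∈ D, s(p.1, p.2) ∈ edgesIn G Λ := by
    rintro ⟨x, y⟩ hp
    rw [hD, Finset.mem_filter, Finset.mem_product] at hp
    rw [mem_edgesIn_iff]
    refine ⟨(SimpleGraph.mem_edgeSet G).2 hp.2, ?_⟩
    intro z hz
    rcases Sym2.mem_iff.1 hz with rfl | rfl
    exacts [hp.1.1, hp.1.2]
  have h2 : ∑ p ∈ D, bondSpin σ s(p.1, p.2) = ∑ e ∈ edgesIn G Λ, 2 * bondSpin σ e := by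
    rw [← Finset.sum_fiberwise_of_maps_to hmaps]
    refine Finset.sum_congr rfl fun e he => ?_
    have h3 : ∑ p ∈ D.filter (fun p => s(p.1, p.2) = e), bondSpin σ s(p.1, p.2) =
        ∑ p ∈ D.filter (fun p => s(p.1, p.2) = e), bondSpin σ e :=
      Finset.sum_congr rfl fun p hp => by rw [(Finset.mem_filter.1 hp).2]
    rw [h3, Finset.sum_const, nsmul_eq_mul]
    congr 1
    rw [mem_edgesIn_iff] at he
    induction e using Sym2.ind with
    | _ a b =>
      have hadj : G.Adj a b := (SimpleGraph.mem_edgeSet G).1 he.1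
      have hab : a ≠ b := G.ne_of_adj hadj
      have ha : a ∈ Λ := he.2 a (Sym2.mem_mk_left a b)
      have hb : b ∈ Λ := he.2 b (Sym2.mem_mk_right a b)
      have h4 : D.filter (fun p : V × V => s(p.1, p.2) = s(a, b)) = {(a, b), (b, a)} := by
        ext ⟨x, y⟩
        rw [Finset.mem_filter, hD, Finset.mem_filter, Finset.mem_product, Finset.mem_insert,
          Finset.mem_singleton, Sym2.eq_iff]
        constructor
        · rintro ⟨_, ⟨rfl, rfl⟩ | ⟨rfl, rfl⟩⟩
          · exact Or.inl rfl
          · exact Or.inr rfl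
        · rintro (h | h)
          · rw [Prod.mk.injEq] at h
            obtain ⟨rfl, rfl⟩ := h
            exact ⟨⟨⟨ha, hb⟩, hadj⟩, Or.inl ⟨rfl, rfl⟩⟩
          · rw [Prod.mk.injEq] at h
            obtain ⟨rfl, rfl⟩ := h
            exact ⟨⟨⟨hb, ha⟩, hadj.symm⟩, Or.inr ⟨rfl, rfl⟩⟩
      rw [h4, Finset.card_pair (fun h => hab (Prod.mk.inj h).1)]
      norm_num
  rw [← h1, h2, ← Finset.mul_sum]
  ring

open Classical in
/-- **The coupling matrix of the volume `Λ`**: `J_{xy} = β/2` for neighbours `x ∼ y` in `Λ`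
(the ordered double sum of `pairEnergy` counts each edge twice), `0` otherwise; nonnegative for
`β ≥ 0`. [cite: DingSongSun2022, §1, eq. (1.1)] -/
def couplingMatrix (Λ : Finset V) (β : ℝ) : ↥Λ → ↥Λ → ℝ :=
  fun x y => if G.Adj x y then β / 2 else 0

omit [DecidableEq V] [G.LocallyFinite] in
/-- The coupling matrix is ferromagnetic for `β ≥ 0`. [cite: DingSongSun2022, §1, eq. (1.1)] -/
theorem couplingMatrix_nonneg (Λ : Finset V) {β : ℝ} (hβ : 0 ≤ β) :
    ∀ x y, 0 ≤ couplingMatrix G Λ β x y := by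
  intro x y
  unfold couplingMatrix
  split_ifs
  exacts [by linarith, le_rfl]

/-- **The boundary condition as a field** on the sites of `Λ`: `0` for the free boundary
condition, `∑_{y ∼ x, y ∉ Λ} η_y` for the boundary condition fixed to `η` (Ding–Song–Sun 2022, §1:
a frozen spin "has the same effect as removing `u` from the graph and adding an extra field
`±J_{uv}` to each neighbour"; Friedli–Velenik 2017, §3.8.1, p. 141). [cite: DingSongSun2022, §1, before Theorem 1.1] -/
def bcField (Λ : Finset V) : BoundaryCondition V → V → ℝ
  | .free => fun _ => 0
  | .fixed η => bdryField G Λ η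

/-- The field of the pair model representing `μ^{bc}_{Λ;β,φ}`: `β φ_x + β · (boundary field)_x`.
[cite: DingSongSun2022, §1, eq. (1.1)] -/
def siteField (Λ : Finset V) (β : ℝ) (φ : V → ℝ) (bc : BoundaryCondition V) : ↥Λ → ℝ :=
  fun x => β * φ x + β * bcField G Λ bc x

/-- The interacting bonds of `ℋ^{bc}_Λ` are the bonds inside `Λ` plus the boundary field
(Friedli–Velenik 2017, §3.1, eq. (3.6), regrouped). [cite: FriedliVelenik2017, §3.1, eq. (3.6)] -/
theorem sum_interactionEdges_bondSpin (Λ : Finset V) (bc : BoundaryCondition V) (τ : SpinConfig ↥Λ) :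
    ∑ e ∈ interactionEdges G Λ bc, bondSpin (glue Λ τ bc) e =
      ∑ e ∈ edgesIn G Λ, bondSpin (glue Λ τ bc) e +
        ∑ x ∈ Λ, bcField G Λ bc x * spinAt x (glue Λ τ bc) := by
  cases bc with
  | free => simp [bcField]
  | fixed η =>
    rw [interactionEdges_fixed, ← Finset.sum_sdiff (edgesIn_subset_edgesTouching (G := G) Λ),
      show edgesTouching G Λ \ edgesIn G Λ = edgeBoundary G Λ from rfl, sum_edgeBoundary_bondSpin,
      add_comm]
    congr 1
    refine Finset.sum_congr rfl fun y _ => ?_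
    rw [mul_comm]
    simp only [bcField, bdryField]
    congr 1
    refine Finset.sum_congr rfl fun z hz => ?_
    rw [mem_outNbrs] at hz
    rw [spinAt_glue_of_not_mem τ (.fixed η) hz.2]
    rfl

omit [DecidableEq V] [G.LocallyFinite] in
/-- A double sum over the sites of `Λ` as a subtype is a double sum over `Λ`. [folklore] -/
theorem sum_sum_coe_sort (Λ : Finset V) (F : V → V → ℝ) :
    ∑ x : ↥Λ, ∑ y : ↥Λ, F x y = ∑ x ∈ Λ, ∑ y ∈ Λ, F x y := by
  rw [← Finset.sum_coe_sort Λ (fun x => ∑ y ∈ Λ, F x y)]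
  exact Finset.sum_congr rfl fun x _ => Finset.sum_coe_sort Λ (fun y => F x y)

/-- The pair interaction of the coupling matrix is `β ∑_{e ∈ ℰ_Λ} σ_e`. [cite: DingSongSun2022, §1, eq. (1.1)] -/
theorem pairEnergy_couplingMatrix (Λ : Finset V) (β : ℝ) (bc : BoundaryCondition V)
    (τ : SpinConfig ↥Λ) :
    DingSongSun2022.pairEnergy (couplingMatrix G Λ β) τ =
      β * ∑ e ∈ edgesIn G Λ, bondSpin (glue Λ τ bc) e := by
  classical
  rw [sum_edgesIn_bondSpin_eq_half, DingSongSun2022.pairEnergy]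
  have h1 : ∑ x : ↥Λ, ∑ y : ↥Λ, couplingMatrix G Λ β x y * (spinAt x τ * spinAt y τ) =
      ∑ x ∈ Λ, ∑ y ∈ Λ, (if G.Adj x y then β / 2 else 0) *
        (spinAt x (glue Λ τ bc) * spinAt y (glue Λ τ bc)) := by
    rw [← sum_sum_coe_sort Λ (fun a b => (if G.Adj a b then β / 2 else 0) *
        (spinAt a (glue Λ τ bc) * spinAt b (glue Λ τ bc)))]
    refine Finset.sum_congr rfl fun x _ => Finset.sum_congr rfl fun y _ => ?_
    simp only [couplingMatrix, spinAt_glue_coe]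
  rw [h1, Finset.mul_sum, Finset.mul_sum]
  refine Finset.sum_congr rfl fun x _ => ?_
  rw [Finset.mul_sum, Finset.mul_sum]
  refine Finset.sum_congr rfl fun y _ => ?_
  split_ifs <;> ring

/-- **The Gibbs weight of `μ^{bc}_{Λ;β,φ}` is the weight of the pair model** with couplings
`couplingMatrix` and field `siteField` (no extra constant). [cite: DingSongSun2022, §1, eq. (1.1)] -/
theorem fieldWeight_eq_weight (Λ : Finset V) (β : ℝ) (φ : V → ℝ) (bc : BoundaryCondition V)
    (τ : SpinConfig ↥Λ) :
    fieldWeight G Λ β φ bc τ =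
      DingSongSun2022.weight (couplingMatrix G Λ β) (siteField G Λ β φ bc) τ := by
  rw [fieldWeight, DingSongSun2022.weight, pairEnergy_couplingMatrix G Λ β bc τ]
  congr 1
  have k2 : DingSongSun2022.fieldEnergy (siteField G Λ β φ bc) τ =
      ∑ x ∈ Λ, (β * φ x + β * bcField G Λ bc x) * spinAt x (glue Λ τ bc) := by
    unfold DingSongSun2022.fieldEnergy siteField
    rw [← Finset.sum_coe_sort Λ]
    exact Finset.sum_congr rfl fun x _ => by rw [spinAt_glue_coe]
  rw [k2, fieldHamiltonian, sum_interactionEdges_bondSpin]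
  simp only [add_mul, Finset.sum_add_distrib]
  have e1 : ∑ x ∈ Λ, β * bcField G Λ bc x * spinAt x (glue Λ τ bc) =
      β * ∑ x ∈ Λ, bcField G Λ bc x * spinAt x (glue Λ τ bc) := by
    rw [Finset.mul_sum]
    exact Finset.sum_congr rfl fun x _ => by ring
  have e2 : ∑ x ∈ Λ, β * φ x * spinAt x (glue Λ τ bc) = β * ∑ x ∈ Λ, φ x * spinAt x (glue Λ τ bc) := by
    rw [Finset.mul_sum]
    exact Finset.sum_congr rfl fun x _ => by ring
  rw [e1, e2]
  ring

/-- **`⟨σ_o⟩^{bc}_{Λ;β,φ} = ⟨σ_o⟩_ψ`** in the pair model on `↥Λ`, for `o ∈ Λ`.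
[cite: DingSongSun2022, §1, eq. (1.1)] -/
theorem fieldExpect_spinAt_eq_avg (Λ : Finset V) (β : ℝ) (φ : V → ℝ) (bc : BoundaryCondition V)
    {o : V} (ho : o ∈ Λ) :
    fieldExpect G Λ β φ bc (spinAt o) =
      DingSongSun2022.avg (couplingMatrix G Λ β) (siteField G Λ β φ bc) (spinAt ⟨o, ho⟩) := by
  rw [fieldExpect_eq_sum_div G Λ β φ bc (measurable_spinAt o), DingSongSun2022.avg,
    DingSongSun2022.wsum, DingSongSun2022.wsum, fieldZ]
  congr 1
  · exact Finset.sum_congr rfl fun τ _ => by rw [fieldWeight_eq_weight, spinAt_glue_of_mem τ bc ho]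
  · exact Finset.sum_congr rfl fun τ _ => by rw [fieldWeight_eq_weight, mul_one]

/-- For `o ∉ Λ` the spin at `o` is frozen to the boundary datum: `⟨σ_o⟩^{bc}_{Λ;β,φ} = bc_o`.
[cite: FriedliVelenik2017, §3.1] -/
theorem fieldExpect_spinAt_of_not_mem (Λ : Finset V) (β : ℝ) (φ : V → ℝ) (bc : BoundaryCondition V)
    {o : V} (ho : o ∉ Λ) : fieldExpect G Λ β φ bc (spinAt o) = spinAt o bc.outside := by
  rw [fieldExpect_eq_sum_div G Λ β φ bc (measurable_spinAt o)]
  have h1 : ∑ τ : SpinConfig ↥Λ, fieldWeight G Λ β φ bc τ * spinAt o (glue Λ τ bc) =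
      fieldZ G Λ β φ bc * spinAt o bc.outside := by
    rw [fieldZ, Finset.sum_mul]
    exact Finset.sum_congr rfl fun τ _ => by rw [spinAt_glue_of_not_mem τ bc ho]
  rw [h1, mul_comm, mul_div_assoc, div_self (fieldZ_pos G Λ β φ bc).ne', mul_one]

end Bridge

end DingSongSun2022

/-- **Ding–Song–Sun 2022, Theorem 1.1 — discharge of the named fact
`DingSongSun2022_signedFieldDomination`**: for a locally finite graph, a finite volume `Λ`,
`β ≥ 0`, any `g`, any `f ≥ 0`, any boundary condition `bc` and any site `o`,
`⟨σ_o⟩^{bc}_{Λ;β,g+f} - ⟨σ_o⟩^{bc}_{Λ;β,g-f} ≤ ⟨σ_o⟩^{free}_{Λ;β,f} - ⟨σ_o⟩^{free}_{Λ;β,-f}`.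
Proof: for `o ∉ Λ` both sides vanish; for `o ∈ Λ` the four expectations are expectations of the
pair model on `↥Λ` with couplings `β/2 · 1_{x∼y}` and fields `β g + β·(bc as a field) ± β f`,
resp. `± β f` (`fieldExpect_spinAt_eq_avg`), and `DingSongSun2022.pair_signedFieldDomination`
(the printed proof of §2) applies. [cite: DingSongSun2022, Theorem 1.1 (§1) and its proof (§2)] -/
theorem DingSongSun2022_signedFieldDomination_holds : DingSongSun2022_signedFieldDomination := by
  intro V G _ _ Λ β hβ g f hf bc o
  by_cases ho : o ∈ Λ
  · rw [DingSongSun2022.fieldExpect_spinAt_eq_avg G Λ β (g + f) bc ho,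
      DingSongSun2022.fieldExpect_spinAt_eq_avg G Λ β (g - f) bc ho,
      DingSongSun2022.fieldExpect_spinAt_eq_avg G Λ β f .free ho,
      DingSongSun2022.fieldExpect_spinAt_eq_avg G Λ β (-f) .free ho]
    have e1 : DingSongSun2022.siteField G Λ β (g + f) bc =
        fun x : ↥Λ => (β * g x + β * DingSongSun2022.bcField G Λ bc x) + β * f x := by
      funext x
      simp only [DingSongSun2022.siteField, Pi.add_apply]
      ring
    have e2 : DingSongSun2022.siteField G Λ β (g - f) bc =
        fun x : ↥Λ => (β * g x + β * DingSongSun2022.bcField G Λ bc x) - β * f x := by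
      funext x
      simp only [DingSongSun2022.siteField, Pi.sub_apply]
      ring
    have e3 : DingSongSun2022.siteField G Λ β f .free = fun x : ↥Λ => β * f x := by
      funext x
      simp [DingSongSun2022.siteField, DingSongSun2022.bcField]
    have e4 : DingSongSun2022.siteField G Λ β (-f) .free = fun x : ↥Λ => -(β * f x) := by
      funext x
      simp [DingSongSun2022.siteField, DingSongSun2022.bcField]
    rw [e1, e2, e3, e4]
    exact DingSongSun2022.pair_signedFieldDomination _
      (DingSongSun2022.couplingMatrix_nonneg G Λ hβ)
      (fun x : ↥Λ => β * g x + β * DingSongSun2022.bcField G Λ bc x) (fun x : ↥Λ => β * f x)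
      (fun x => mul_nonneg hβ (hf x)) ⟨o, ho⟩
  · rw [DingSongSun2022.fieldExpect_spinAt_of_not_mem G Λ β (g + f) bc ho,
      DingSongSun2022.fieldExpect_spinAt_of_not_mem G Λ β (g - f) bc ho,
      DingSongSun2022.fieldExpect_spinAt_of_not_mem G Λ β f .free ho,
      DingSongSun2022.fieldExpect_spinAt_of_not_mem G Λ β (-f) .free ho, sub_self, sub_self]

end Literature.Probability.LatticeModels

end
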